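import Literature.MathematicalPhysics.QuantumFieldTheory.Balaban1983to89.B6Prop22DerivMultiLevelBoxL0
import Literature.MathematicalPhysics.QuantumFieldTheory.Balaban1983to89.B6Ineq243AdjTwoLevelBoxL0
import Literature.MathematicalPhysics.QuantumFieldTheory.Balaban1983to89.B6Ineq243TwoLevelBoxL0
import Literature.MathematicalPhysics.QuantumFieldTheory.Balaban1983to89.B6Prop22AdjTwoLevelBox
import Literature.MathematicalPhysics.QuantumFieldTheory.Balaban1983to89.B6Prop22AdjMultiLevelBox

/-!
# `Balaban1983to89.B6Prop22AdjMultiLevelBoxL0` — LEVEL-0 TWIN (programme G-F3′-L0, director-ym LINE №27 / UV3-NODE §24.5; plan `lit-balaban-r03/G-F3L0-PLAN.md`) of `B6Prop22AdjMultiLevelBox`: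
the same declarations, SAME NAMES AND STATEMENTS, for nested families WITH print's region `Λ₀ = T ∖ Ω₁` ADMITTED (structures
`B6MultiLevelBoxOperatorL0.Domains` / `B6MultiLevelTorusOperatorL0.TDomains`: levels `0, …, k`, the level-`0` block a single site, `Q′₀ = id`,
finite weight `a₀` — print p.225 (2.14) «Σ_{j=0}^k … (Q′₀λ)(x) = λ(x), x ∈ Λ₀», p.229 «taking a sequence (2.1) … smallest possible domains B^j(Λ_j),
and considering the operator Δ_a defined by (2.19), (2.20) for this sequence»).  Every `D`-free object is the lineage's, consumed BY NAME; no existing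
module is touched; no fact is minted.  Unit `lit-balaban-p21` (packet S-B owner, p21 gen 26; port tooling by r03 gen 36); B6 fold owner r03; referee ref-4.  THE TWIN'S DOCUMENTATION FOLLOWS
VERBATIM (its «levels 1 … k» / «Ω₁ = X» sentences describe the twin; here `j` runs from `0` and `Ω₁` may be a proper subset).

# `Balaban1983to89.B6Prop22AdjMultiLevelBox` — [B6] PROPOSITION 2.2, THIRD ENTRY OF (2.67) (`|G′∇^{η*}λ|`), FOR THE
GENUINE `k`-LEVEL OPERATOR `G′ = Δ′_a^{−1}` ON A BOX: `|(G′∇^{η*}λ)(x)| ≤ O(1)L^jη·e^{−½δ₀d(y,y′)}|λ|`, `x ∈ B^j(y)`,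
`supp λ ⊂ B^{j′}(y′)` — by the printed route in TRANSPOSED form: the left fixed point `G′∂* = G′₀ᵀ∂* + Rᵀ(G′∂*)`
(symmetry of `Δ′_a`), conjugated by the level weights `L^{j(x)}`, the column smallness of `R` ((2.44)/(2.49) on the
weighted `ℓ¹`, [3] method) and the chain of Lemma 2.1 (file 9 of the multi-level parametrix; no existing module is
touched; no fact is minted)

FRAMING (verbatim cell line):
statement-level skeleton of published theorems with citation tags; proofs where landed; nothing here is a claim about the Yang–Mills mass gap

Source under audit (cell pub-balaban / lit-balaban): T. Bałaban, *Propagators and renormalization transformations for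
lattice gauge theories. II*, Commun. Math. Phys. **96** (1984) 223–250 [`Balaban1984PropagatorsII`, "B6"], p. 234
[PDF 12] (2.64)–(2.67), Proposition 2.2; p. 230 [PDF 8] (2.43)–(2.44); p. 232 [PDF 10] (2.49)–(2.51) (renders
`run/shared/lean/pub/pub-balaban/b2b-balaban-ref1/pages/1984-cmp96-propagators-rt-II/…-p008/p010/p012-x2.png`, read as
images this generation).  Unit `lit-balaban-p21` (Phase-2 proof seat p21 gen 10), HOME `run/shared/lean/pub/lit-balaban/`,
B6 fold owner r03, referee ref-4.

## WHAT IS PRINTED (p. 234, verbatim up to notation)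

«**Proposition 2.2.** If we have (2.1), (2.2) and M is sufficiently large, then the operator G′ = Δ′_a^{−1} (a = 1)
satisfies the inequalities |(G′λ)(x)|, |(∇^η_xG′λ)(x)|, |(G′∇^{η*}λ)(x)|, … ≤ O(1)[(L^jη)², L^jη, L^jη, …]·
e^{−½δ₀d(y,y′)}|λ|, x ∈ B^j(y) …, y ∈ Λ_j, supp λ ⊂ B^{j′}(y′), y′ ∈ Λ_{j′}. (2.67)»; p. 230 (2.43) lists
`|(G′(□)∇^{η*}λ)(x)|` among the cube estimates proved by the method of [3].

## WHAT THIS FILE CERTIFIES (kernel-checked; setting of files 1–6)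

For the genuine `k`-level operator `Δ′_a = mlOp` of a nested family `D : Domains d ℓ M_h k P R` on the box, `G′ = gml`,
`G′₀ = gZeroML`, `R = rML` (u/v cover of file 2), `𝔅`/`blkOf`/`d` of `geom D` (file 4), `∂_μ = dMat` (file 6):
* §1 tools of the majorant calculus: the LEFT convolution `Σ_{y″}e^{−(1−α)δ₀d(y,y″)}e^{−δ₀d(y″,y′)} ≤ c·e^{−(1−α)δ₀d(y,y′)}`
  ((2.54) + (2.61) at `y′`, `d` symmetric), the identity majorant, row scaling by a block function, row sums from a
  majorant;
* §2 the symmetry `G′ᵀ = G′` and the TRANSPOSED fixed point of (2.38)/(2.50) for `T = G′∂*_μ := G′·∂_μᵀ`: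
  `T = G′₀ᵀ∂_μᵀ + RᵀT` (`fixedPoint_transpose`), and its conjugate by `Λ = diag(L^{j(x)})`:
  `T̃ = T̃₀ + S·T̃`, `T̃ = Λ^{−1}T`, `T̃₀ = Λ^{−1}G′₀ᵀ∂ᵀ`, `S = Λ^{−1}RᵀΛ`;
* §3 **THE MAJORANT OF `S`**: `θ′·e^{−δd/(d+1)}` with `θ′ = K′/M_h` — the column `x` of a cube term
  `K_□(h_□)G′(□)v_□` is `v_□(x)·(−K_□(h_□)·(row x of G′(□)))` (`E_□`, `G′(□)` symmetric, `K(h)ᵀ = −K(h)`), its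
  weighted `ℓ¹` is `O(1/M)` by the three terms of (2.40) (`B6Prop22AdjTwoLevelBox.wsum_kComm_le` with the rows (2.43)₁
  and the bond sums `B6Ineq243AdjTwoLevelBox.ineq243_twoLevel_dstar_roww` of `G′(□)`), the levels of two sites of one
  cube differ by at most one (`L^{j(z)−j(x)} ≤ L`), the support distance read from `d`, finite overlap;
* §4 **THE MAJORANT OF `T̃₀`**: `A·e^{−δd/(d+1)}` — summation by parts on the column, the product rule
  `∂*_z(G′(□)(x,z)h_□(z))`, the bond sums of `G′(□)∂*` and the rows of `G′(□)` times `|∂h_□| ≤ (d+1)D₁/L^{j_□}`,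
  lattice-unit factors `L^{2i_□}/L^{j(x)} ≤ L^{i_□}·1`;
* §5 **PROPOSITION 2.2, THIRD ENTRY, FOR THE GENUINE `k`-LEVEL OPERATOR** `prop22_third_multiLevelBox`: there are
  `δ₀, C, M₀ > 0`, `N₀ ≥ 1` such that for every `k`, `M_h ≥ 3` with `L·M_h ≥ M₀`, `R ≥ 2L` with `RM ≥ N₀ + 1`, volume,
  nested family `D`, weights in the windows with `a_{i+1} = aNext ℓ a_i c_i`, and axis `μ`:
  `|(G′∂_μᵀλ)(x)| ≤ C·L^{j}·e^{−½δ₀d(y,y′)}|λ|` (`HasMajorant (blkOf D) (toLin' (gml * (dMat μ)ᵀ))`) — `1 − S` is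
  invertible by its row sums (`B6Prop23Chain.isUnit_one_sub`), `U = (1 − S)^{−1} = 1 + U·S` gets its majorant from the
  chain `B6Prop23Chain.majorant_of_fixedPoint_266W` with `G₀ = 1`, `T̃ = U·T̃₀` by the left convolution, `T = ΛT̃`.

## HONEST SCOPE

As files 1–8: levels `1 … k` on a Neumann box, `m² = 0`, asymmetric partition, `M_h ≥ 3`; lattice units (`∂ᵀ = η∇^{η*}`
up to the sign convention of the adjoint difference; `L^{j}` for «L^jη»); the (2.61)-constant is the `L`-dependent
series constant of `B6Ineq261LevelGap`; «M sufficiently large» here is `M_h ≥ M₀/L` with `M₀` depending on `L`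
(stated as `M₀ ≤ L·M_h`); constants existential.  Nothing is inferred from the manuscript: every step is kernel-checked.
-/

namespace Literature.MathematicalPhysics.QuantumFieldTheory.Balaban1983to89.B6Prop22AdjMultiLevelBoxL0

open Finset Matrix
open Literature.MathematicalPhysics.QuantumFieldTheory.Balaban1983to89.B4ContourShift (supNorm abs_le_supNorm
  supNorm_nonneg)
open Literature.MathematicalPhysics.QuantumFieldTheory.Balaban1983to89.B4Reflection242 (boxDom mem_boxDom blk nbrs
  mem_nbrs)
open Literature.MathematicalPhysics.QuantumFieldTheory.Balaban1983to89.B4Lemma22ReduceZero (Box)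
open Literature.MathematicalPhysics.QuantumFieldTheory.Balaban1983to89.B4Lemma22ZeroBoxDerivDual (fwd fwd_eq_of_nbr
  fwd_val_of_mem fwd_of_not_mem)
open Literature.MathematicalPhysics.QuantumFieldTheory.Balaban1983to89.B4Green242Bridge (boxNbrs)
open Literature.MathematicalPhysics.QuantumFieldTheory.Balaban1983to89.B4PartitionUnity22 (hprof D1 D2 D1_nonneg D2_nonneg
  contDiff_hprof hasCompactSupport_hprof)
open Literature.MathematicalPhysics.QuantumFieldTheory.Balaban1983to89.B4Thm110ZeroBox (boxCast boxCast_apply_val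
  boxCast_symm_apply_val mem_boxDom_of_eq roww mulVec_le_of_roww)
open Literature.MathematicalPhysics.QuantumFieldTheory.Balaban1983to89.B4Thm110ZeroBoxDeriv (wsum supNorm_single_le
  supNorm_sub_le_nbr supNorm_nbr_sub_le)
open Literature.MathematicalPhysics.QuantumFieldTheory.Balaban1983to89.B6Ineq243TwoLevelBox
open Literature.MathematicalPhysics.QuantumFieldTheory.Balaban1983to89.B6Ineq243AdjTwoLevelBox (dstar dstar_apply roww_dstar
  ineq243_twoLevel_dstar_roww)
open Literature.MathematicalPhysics.QuantumFieldTheory.Balaban1983to89.B6Partition236TwoLevelBox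
open Literature.MathematicalPhysics.QuantumFieldTheory.Balaban1983to89.B6Eq238TwoLevelBox
open Literature.MathematicalPhysics.QuantumFieldTheory.Balaban1983to89.B6Ineq249TwoLevelBox (near card_near_le
  mem_near_of_abs_lt emb_sub_emb)
open Literature.MathematicalPhysics.QuantumFieldTheory.Balaban1983to89.B6Prop22AdjTwoLevelBox (wsum_kComm_le
  kComm_transpose mul_kComm_apply hLoc_lipschitz hLoc_laplacian_le)
open Literature.MathematicalPhysics.QuantumFieldTheory.Balaban1983to89.B6MultiLevelBoxOperator hiding Domains mlOp_apply
open Literature.MathematicalPhysics.QuantumFieldTheory.Balaban1983to89.B6MultiLevelBoxOperatorL0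
open Literature.MathematicalPhysics.QuantumFieldTheory.Balaban1983to89.B6Eq238MultiLevelBox hiding Active CubeData Down Ep LamG aX bX cG cOp cOp_mul_cG ctrs_Pj_subset cubeData_of_mem cubeSet diagonal_mul_eq_pad eq238_multiLevelBox fin fin_data fin_spec gX gZeroML isBlockUnion_LamG lev_corner_ublk mem_LamG mem_cubeSet mlOp_emb_emb mlOp_emb_off mlOp_mul_aX mlOp_mul_term rML row_eq_pad_row sum_uv_eq_one vFun vX window_of_active
open Literature.MathematicalPhysics.QuantumFieldTheory.Balaban1983to89.B6Eq238MultiLevelBoxL0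
open Literature.MathematicalPhysics.QuantumFieldTheory.Balaban1983to89.B6Ineq249MultiLevelBox hiding abs_vFun_le_one bX_eq bX_mulVec_apply embC eq250_multiLevelBox innerB local_comm_bound mem_keySet_of_bX_ne_zero norm_rML_le
open Literature.MathematicalPhysics.QuantumFieldTheory.Balaban1983to89.B6Ineq249MultiLevelBoxL0
open Literature.MathematicalPhysics.QuantumFieldTheory.Balaban1983to89.B6Geom246MultiLevelBox hiding Touch blkOf blkOf_corner blkOf_eq_iff_blk blkOf_eq_of_blk_i_eq blkOf_val bond bond_adj bset cen connected coord_bounds corner corner_mem csys dist_blkOf_le_box dist_blkOf_le_coord dist_blkOf_le_line dist_cen_le_of_adj dist_cen_le_of_touch dist_le_one_of_near dist_toR_cen_le exists_blkOf_eq geom lemma21_box lev_corner lev_eq_of_blkOf_eq levelGap pack reachable_blkOf reachable_of_near realizes scale_bounds touch_symm triangle_refl_nonneg walk_disp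
open Literature.MathematicalPhysics.QuantumFieldTheory.Balaban1983to89.B6Geom246MultiLevelBoxL0
open Literature.MathematicalPhysics.QuantumFieldTheory.Balaban1983to89.B6Prop22MultiLevelBox hiding Dd_le_supNorm aX_mulVec_apply bX_row_img bX_row_off dist_blkOf_le_in_cube fixedPoint_gml gX_row_img gX_row_off gZeroML_majorant lev_window_of_inCube mem_keySet_of_aX_ne_zero prop22_first_multiLevelBox rML_majorant
open Literature.MathematicalPhysics.QuantumFieldTheory.Balaban1983to89.B6Prop22MultiLevelBoxL0
open Literature.MathematicalPhysics.QuantumFieldTheory.Balaban1983to89.B6Prop22DerivMultiLevelBox (dMat dMat_mulVec_of_mem dMat_mulVec_of_not_mem)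
open Literature.MathematicalPhysics.QuantumFieldTheory.Balaban1983to89.B6Prop22DerivMultiLevelBoxL0 (img_of_uX_ne_zero mem_keySet_of_uX_ne_zero)
open Literature.MathematicalPhysics.QuantumFieldTheory.Balaban1983to89.B6RandomWalk (HasMajorant BlockSupp
  hasMajorant_mono hasMajorant_mul Triangle254)
open Literature.MathematicalPhysics.QuantumFieldTheory.Balaban1983to89.B6Lemma21Repaired (Ineq261With Ineq263With)
open Literature.MathematicalPhysics.QuantumFieldTheory.Balaban1983to89.B6Ineq261LevelGap (K261 K261_nonneg
  theta_lt_one_of_log)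
open Literature.MathematicalPhysics.QuantumFieldTheory.Balaban1983to89.B6Prop23Chain (majorant_of_fixedPoint_266W
  mat isUnit_one_sub)

open Literature.MathematicalPhysics.QuantumFieldTheory.Balaban1983to89.B6Prop22AdjMultiLevelBox (conv_left_le majorant_mul_left hasMajorant_one hasMajorant_diagonal_mul rowSum_le_of_hasMajorant gml_transpose)
noncomputable section

variable {d : ℕ}

/-! ## §0 The Laplacian of the cut-off seen from its cube, at every mesh (`L^k·M ≥ 4`, `k ≥ 0`) -/

section CutoffRoom

variable {ℓ k Mh : ℕ} {P : Fin (d + 1) → ℕ}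

/-- **«Δh = O(M^{−2})» FOR THE CUT-OFF SEEN FROM ITS CUBE, AT EVERY MESH** (faces included): `|n²Σ_{z′∼z}(h_q(z′) − h_q(z))|
≤ (d+1)sup|h″|/M²` — the twin's `B6Prop22AdjTwoLevelBox.hLoc_laplacian_le` with its hypothesis `1 ≤ k` (used there only for
`L^k·L·M_h ≥ 4`) replaced by `2 ≤ M_h`, so that the mesh-one cubes of level `0` are covered (`B6Partition236TwoLevelBox.hloc_laplacian`).
[cite: Balaban1984PropagatorsII, (2.40)/(2.44) p.230] -/
theorem hLoc_laplacian_le' (hℓ : 1 ≤ ℓ) (hMh : 2 ≤ Mh) (hP : ∀ i, 1 ≤ P i) {q : Fin (d + 1) → ℤ}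
    (hq : q ∈ ctrs P) (z : ↥(Box d ℓ k (fun i => (ℓ + 1) * cubeM' Mh P q i))) :
    |((((ℓ + 1) ^ k : ℕ) : ℝ)) ^ 2 * ∑ z' ∈ boxNbrs _ z, (hLoc ℓ k Mh P q z' - hLoc ℓ k Mh P q z)|
      ≤ (d + 1) * (D2 hprof / (((ℓ : ℝ) + 1) * Mh) ^ 2) := by
  have hN4 : 4 ≤ (ℓ + 1) ^ k * ((ℓ + 1) * Mh) := four_le_scale hℓ hMh
  obtain hcw := fun i => cubeW_cases hP hq i
  have hl := hloc_laplacian (d := d) (n := (ℓ + 1) ^ k) (M := (ℓ + 1) * Mh) hN4 (c := locLabel q)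
    (w := fun i => cubeW P q i) (S := fun i => (ℓ + 1) ^ k * ((ℓ + 1) * cubeM' Mh P q i))
    (fun i => by simp only [cubeM']; ring) (fun i => (hcw i).1) (fun i => (hcw i).2) z
  rw [abs_mul, abs_of_nonneg (by positivity)]
  have hNsq : ((((ℓ + 1) ^ k : ℕ) : ℝ)) ^ 2 * ((d + 1) * (D2 hprof / ((((ℓ + 1) ^ k * ((ℓ + 1) * Mh) : ℕ) : ℝ)) ^ 2))
      = (d + 1) * (D2 hprof / (((ℓ : ℝ) + 1) * Mh) ^ 2) := by
    push_cast
    have : (((ℓ : ℝ) + 1) ^ k) ≠ 0 := by positivity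
    have : ((ℓ : ℝ) + 1) * Mh ≠ 0 := by
      have : (2 : ℝ) ≤ Mh := by exact_mod_cast hMh
      positivity
    field_simp
  calc ((((ℓ + 1) ^ k : ℕ) : ℝ)) ^ 2 * |∑ z' ∈ boxNbrs _ z, (hLoc ℓ k Mh P q z' - hLoc ℓ k Mh P q z)|
      ≤ ((((ℓ + 1) ^ k : ℕ) : ℝ)) ^ 2 * ((d + 1) * (D2 hprof / ((((ℓ + 1) ^ k * ((ℓ + 1) * Mh) : ℕ) : ℝ)) ^ 2)) :=
        mul_le_mul_of_nonneg_left hl (by positivity)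
    _ = _ := hNsq

end CutoffRoom

/-! ## §1 Tools of the majorant calculus -/

section Tools

variable {g : B6.Geometry} {X : Type}

variable {N : Fin (d + 1) → ℕ}

/-- `mat (toLin' S) = S`. [folklore] -/
private theorem mat_toLin' (S : Matrix ↥(boxDom N) ↥(boxDom N) ℝ) (x z : ↥(boxDom N)) :
    mat (Matrix.toLin' S) x z = S x z := by
  unfold mat
  rw [Matrix.toLin'_apply, Matrix.mulVec_single_one]
  rfl

end Tools

/-! ## §2 Symmetry, the transposed fixed point and its conjugate -/

section FixedPoint

variable {ℓ Mh k R : ℕ} {P : Fin (d + 1) → ℕ}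

/-- the level weights `Λ = diag(L^{j(x)})` and `Λ⁻¹ = diag(L^{−j(x)})`. [cite: Balaban1984PropagatorsII, (2.67) p.234 (the factor L^jη), dictionary] -/
def levW (D : Domains d ℓ Mh k P R) (s : ℤ) : Matrix ↥(boxDom (N0 ℓ Mh k P)) ↥(boxDom (N0 ℓ Mh k P)) ℝ :=
  Matrix.diagonal fun x => (((ℓ : ℝ) + 1) ^ D.lev x.1) ^ s

/-- `Λ^{s}Λ^{t} = Λ^{s+t}`. [folklore] -/
private theorem levW_mul (D : Domains d ℓ Mh k P R) (s t : ℤ) : levW D s * levW D t = levW D (s + t) := by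
  unfold levW
  rw [Matrix.diagonal_mul_diagonal]
  refine congrArg Matrix.diagonal (funext fun x => ?_)
  have hL : (((ℓ : ℝ) + 1) ^ D.lev x.1) ≠ 0 := by positivity
  rw [← zpow_add₀ hL]

/-- `Λ^{0} = 1`. [folklore] -/
private theorem levW_zero (D : Domains d ℓ Mh k P R) : levW D 0 = 1 := by
  unfold levW
  simp

/-- **THE TRANSPOSED FIXED POINT `G′∂ᵀ = G′₀ᵀ∂ᵀ + Rᵀ(G′∂ᵀ)`** of (2.38)/(2.50) for the genuine operator (transpose
`G′ = G′₀ + G′R` and use `G′ᵀ = G′`). [cite: Balaban1984PropagatorsII, (2.38) p.229, (2.50) p.232, (2.66)–(2.67) p.234 (third entry)] -/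
theorem fixedPoint_transpose (D : Domains d ℓ Mh k P R) {a c : ℕ → ℝ} (hℓ : 1 ≤ ℓ) (hR : 2 * (ℓ + 1) ≤ R)
    (hP : ∀ μ, 1 ≤ P μ) (hMh : 2 ≤ Mh) (ha : ∀ i, 0 < a i) (hcpos : ∀ i, 0 < c i)
    (hac : ∀ i, a (i + 1) = aNext ℓ (a i) (c i)) (Dm : Matrix ↥(boxDom (N0 ℓ Mh k P)) ↥(boxDom (N0 ℓ Mh k P)) ℝ) :
    gml (N0 ℓ Mh k P) ℓ k D.lev a * Dm
      = (gZeroML D a c hP)ᵀ * Dm + (rML D a c hP)ᵀ * (gml (N0 ℓ Mh k P) ℓ k D.lev a * Dm) := by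
  have h238 := eq238_multiLevelBox (D := D) (a := a) (c := c) hℓ hR hP hMh ha hcpos hac
  have hGE : gml (N0 ℓ Mh k P) ℓ k D.lev a * mlOp (N0 ℓ Mh k P) ℓ k D.lev a = 1 :=
    gml_mul_mlOp (fun ν => Nat.one_le_iff_ne_zero.2 (by have := hP ν; have := hMh; positivity)) D.lev_le ha
  have hmat : gml (N0 ℓ Mh k P) ℓ k D.lev a
      = gZeroML D a c hP + gml (N0 ℓ Mh k P) ℓ k D.lev a * rML D a c hP := by
    have h := congrArg (fun T => gml (N0 ℓ Mh k P) ℓ k D.lev a * T) h238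
    rw [← Matrix.mul_assoc, hGE, Matrix.one_mul, Matrix.mul_sub, Matrix.mul_one] at h
    rw [h]; abel
  have hT : gml (N0 ℓ Mh k P) ℓ k D.lev a
      = (gZeroML D a c hP)ᵀ + (rML D a c hP)ᵀ * gml (N0 ℓ Mh k P) ℓ k D.lev a := by
    have h := congrArg Matrix.transpose hmat
    rw [Matrix.transpose_add, Matrix.transpose_mul, gml_transpose] at h
    exact h
  conv_lhs => rw [hT]
  rw [Matrix.add_mul, Matrix.mul_assoc]

/-- **THE CONJUGATED FIXED POINT** `T̃ = T̃₀ + S·T̃` with `T̃ = Λ^{−1}G′∂ᵀ`, `T̃₀ = Λ^{−1}G′₀ᵀ∂ᵀ`, `S = Λ^{−1}RᵀΛ`.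
[cite: Balaban1984PropagatorsII, (2.66)–(2.67) p.234 (third entry), dictionary] -/
theorem fixedPoint_conj (D : Domains d ℓ Mh k P R) {a c : ℕ → ℝ} (hℓ : 1 ≤ ℓ) (hR : 2 * (ℓ + 1) ≤ R)
    (hP : ∀ μ, 1 ≤ P μ) (hMh : 2 ≤ Mh) (ha : ∀ i, 0 < a i) (hcpos : ∀ i, 0 < c i)
    (hac : ∀ i, a (i + 1) = aNext ℓ (a i) (c i)) (Dm : Matrix ↥(boxDom (N0 ℓ Mh k P)) ↥(boxDom (N0 ℓ Mh k P)) ℝ) :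
    levW D (-1) * (gml (N0 ℓ Mh k P) ℓ k D.lev a * Dm)
      = levW D (-1) * ((gZeroML D a c hP)ᵀ * Dm)
        + (levW D (-1) * (rML D a c hP)ᵀ * levW D 1) * (levW D (-1) * (gml (N0 ℓ Mh k P) ℓ k D.lev a * Dm)) := by
  have h1 : levW D 1 * levW D (-1) = 1 := by rw [levW_mul]; norm_num; exact levW_zero D
  conv_lhs => rw [fixedPoint_transpose D hℓ hR hP hMh ha hcpos hac Dm]
  rw [Matrix.mul_add]
  congr 1
  simp only [Matrix.mul_assoc]
  rw [← Matrix.mul_assoc (levW D 1), h1, Matrix.one_mul]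

end FixedPoint

/-! ## §3 The majorant of `S = Λ^{−1}RᵀΛ` (the columns of `R` are small) -/

section SMajorant

variable {ℓ Mh k R : ℕ} {P : Fin (d + 1) → ℕ} {D : Domains d ℓ Mh k P R} {a c : ℕ → ℝ}

/-- a sum over a finite type whose non-zero terms are indexed injectively into a finset `T` and are bounded by
`B ≥ 0` is at most `|T|·B`. [folklore] -/
private theorem sum_le_card_mul {ι σ : Type*} [Fintype ι] [DecidableEq σ] (f : ι → ℝ) (key : ι → σ)
    (hkey : Function.Injective key) (T : Finset σ) (hT : ∀ i, f i ≠ 0 → key i ∈ T) {B : ℝ} (hB : 0 ≤ B)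
    (hf : ∀ i, f i ≤ B) : ∑ i, f i ≤ T.card * B := by
  classical
  rw [← Finset.sum_filter_ne_zero]
  have hcard : (Finset.univ.filter fun i => f i ≠ 0).card ≤ T.card :=
    Finset.card_le_card_of_injOn key (fun i hi => by
      rw [Finset.coe_filter] at hi; exact hT i hi.2) (fun i _ j _ h => hkey h)
  calc ∑ i ∈ Finset.univ.filter (fun i => f i ≠ 0), f i
      ≤ (Finset.univ.filter fun i => f i ≠ 0).card • B := Finset.sum_le_card_nsmul _ _ _ fun i _ => hf i
    _ = ((Finset.univ.filter fun i => f i ≠ 0).card : ℝ) * B := by rw [nsmul_eq_mul]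
    _ ≤ T.card * B := mul_le_mul_of_nonneg_right (by exact_mod_cast hcard) hB

/-- a weighted `ℓ¹` bound gives decay against bounded vectors supported at sup-distance `≥ D`. [folklore] -/
private theorem sum_mul_le_of_wrow {X : Type*} [Fintype X] {δ n c F Dd : ℝ} (hn : 0 < n) (hF0 : 0 ≤ F)
    (r u : X → ℝ) (dist : X → ℝ) (hrow : ∑ z, |r z| * Real.exp (δ * dist z / n) ≤ c)
    (hF : ∀ z, |u z| ≤ F) (hD : ∀ z, u z ≠ 0 → Dd ≤ dist z) (hδ : 0 ≤ δ) :
    |∑ z, r z * u z| ≤ c * Real.exp (-(δ * Dd / n)) * F := by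
  have hterm : ∀ z, |r z * u z| ≤ |r z| * Real.exp (δ * dist z / n) * (Real.exp (-(δ * Dd / n)) * F) := by
    intro z
    by_cases hz : u z = 0
    · rw [hz, mul_zero, abs_zero]; positivity
    rw [abs_mul]
    have h1 : 1 ≤ Real.exp (δ * dist z / n) * Real.exp (-(δ * Dd / n)) := by
      rw [← Real.exp_add]
      refine Real.one_le_exp ?_
      have := div_le_div_of_nonneg_right (mul_le_mul_of_nonneg_left (hD z hz) hδ) hn.le
      linarith
    calc |r z| * |u z| ≤ |r z| * (1 * F) := by
          rw [one_mul]; exact mul_le_mul_of_nonneg_left (hF z) (abs_nonneg _)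
      _ ≤ |r z| * (Real.exp (δ * dist z / n) * Real.exp (-(δ * Dd / n)) * F) :=
          mul_le_mul_of_nonneg_left (mul_le_mul_of_nonneg_right h1 hF0) (abs_nonneg _)
      _ = |r z| * Real.exp (δ * dist z / n) * (Real.exp (-(δ * Dd / n)) * F) := by ring
  calc |∑ z, r z * u z| ≤ ∑ z, |r z * u z| := Finset.abs_sum_le_sum_abs _ _
    _ ≤ ∑ z, |r z| * Real.exp (δ * dist z / n) * (Real.exp (-(δ * Dd / n)) * F) :=
        Finset.sum_le_sum fun z _ => hterm z
    _ = (∑ z, |r z| * Real.exp (δ * dist z / n)) * (Real.exp (-(δ * Dd / n)) * F) := by rw [Finset.sum_mul]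
    _ ≤ c * (Real.exp (-(δ * Dd / n)) * F) := mul_le_mul_of_nonneg_right hrow (by positivity)
    _ = c * Real.exp (-(δ * Dd / n)) * F := by ring

/-- the exponent bookkeeping: `e^{−δD/L^i} = e^{δ}·e^{−(δ/(d+1))·dist}` for `D = L^i(dist/(d+1) − 1)`. [folklore] -/
private theorem exp_Dd_eq {δ n dist : ℝ} (hn : 0 < n) (d : ℕ) :
    Real.exp (-(δ * (n * (dist / (d + 1) - 1)) / n)) = Real.exp δ * Real.exp (-(δ / (d + 1) * dist)) := by
  rw [← Real.exp_add]
  congr 1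
  field_simp
  ring

/-- reindexed matrices act by conjugation with the equivalence. [folklore] -/
private theorem reindex_mulVec_apply {X Y : Type*} [Fintype X] [Fintype Y] (e : X ≃ Y) (A : Matrix X X ℝ) (v : Y → ℝ)
    (z : Y) : (Matrix.reindex e e A *ᵥ v) z = (A *ᵥ (v ∘ e)) (e.symm z) := by
  rw [Matrix.reindex_apply, Matrix.submatrix_mulVec_equiv, Equiv.symm_symm, Function.comp_apply]

/-- **THE COLUMN OF A CUBE TERM OF `R`**: at a site `x = □-image of b` the column `x` of `K_□(h_□)G′(□)v_□`, applied to
`f`, is `v_□(x)·Σ_z (K_□(h_□)·(row b of G′(□)))(z)·f(z)` (`E_□`, `G′(□)` symmetric, `K(h)ᵀ = −K(h)`).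
[cite: Balaban1984PropagatorsII, (2.38) p.229, (2.40)/(2.44) p.230, dictionary] -/
theorem bX_transpose_mulVec_img (hP : ∀ μ, 1 ≤ P μ) (cq : ℕ × (Fin (d + 1) → ℤ)) (hc : B6Eq238MultiLevelBoxL0.CubeData D cq)
    (f : ↥(boxDom (N0 ℓ Mh k P)) → ℝ) {x : ↥(boxDom (N0 ℓ Mh k P))}
    {b : ↥(Box d ℓ (fin D cq.1 cq.2)
      (fun μ => (ℓ + 1) * cubeM' (MhP ℓ Mh cq.1 (fin D cq.1 cq.2)) (Pj ℓ k P cq.1) cq.2 μ))}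
    (hb : embC D hP cq hc b = (castP (ℓ := ℓ) (Mh := Mh) (P := P) (fin_data hc).2.1 hc.hj.2).symm x) :
    ((bX D a c hP cq hc)ᵀ *ᵥ f) x
      = ((fun z => vFun D cq.1 cq.2 z.1) ∘ embC D hP cq hc) b
        * ∑ z, (kComm (cOp D a c cq.1 (fin D cq.1 cq.2) cq.2 hP hc.hq)
              (hLoc ℓ (fin D cq.1 cq.2) (MhP ℓ Mh cq.1 (fin D cq.1 cq.2)) (Pj ℓ k P cq.1) cq.2)
            *ᵥ (fun z' => cG D a c cq.1 (fin D cq.1 cq.2) cq.2 hP hc.hq b z')) z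
          * f (castP (fin_data hc).2.1 hc.hj.2 (embC D hP cq hc z)) := by
  have hinj : Function.Injective (embC D hP cq hc) := emb_injective _ hc.hq
  have hEs : (cOp D a c cq.1 (fin D cq.1 cq.2) cq.2 hP hc.hq).IsSymm := twoLevelOp_isSymm _ _ _ _ _ _ _
  have hGs : (cG D a c cq.1 (fin D cq.1 cq.2) cq.2 hP hc.hq)ᵀ = cG D a c cq.1 (fin D cq.1 cq.2) cq.2 hP hc.hq :=
    (gTwoLevel_isSymm _ _ _ _ _ _ _).eq
  have hKs := kComm_transpose _ hEs
    (hLoc ℓ (fin D cq.1 cq.2) (MhP ℓ Mh cq.1 (fin D cq.1 cq.2)) (Pj ℓ k P cq.1) cq.2)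
  rw [bX_eq, Matrix.transpose_reindex, reindex_mulVec_apply, ← hb]
  unfold innerB
  rw [Matrix.transpose_mul, Matrix.transpose_mul, Matrix.transpose_transpose, ← Matrix.mulVec_mulVec,
    ← Matrix.mulVec_mulVec, transpose_res_mulVec_img hinj, Matrix.transpose_mul, Matrix.transpose_mul,
    Matrix.diagonal_transpose, hGs, hKs, ← Matrix.mulVec_mulVec, Matrix.mulVec_diagonal]
  congr 1
  rw [Matrix.mul_neg, Matrix.neg_mulVec, Pi.neg_apply]
  have hL : ((cG D a c cq.1 (fin D cq.1 cq.2) cq.2 hP hc.hq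
        * kComm (cOp D a c cq.1 (fin D cq.1 cq.2) cq.2 hP hc.hq)
            (hLoc ℓ (fin D cq.1 cq.2) (MhP ℓ Mh cq.1 (fin D cq.1 cq.2)) (Pj ℓ k P cq.1) cq.2))
        *ᵥ (res (embC D hP cq hc) *ᵥ (f ∘ castP (fin_data hc).2.1 hc.hj.2))) b
      = ∑ z, (cG D a c cq.1 (fin D cq.1 cq.2) cq.2 hP hc.hq
          * kComm (cOp D a c cq.1 (fin D cq.1 cq.2) cq.2 hP hc.hq)
              (hLoc ℓ (fin D cq.1 cq.2) (MhP ℓ Mh cq.1 (fin D cq.1 cq.2)) (Pj ℓ k P cq.1) cq.2)) b z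
          * (res (embC D hP cq hc) *ᵥ (f ∘ castP (fin_data hc).2.1 hc.hj.2)) z := by
    simp only [Matrix.mulVec, dotProduct]
  rw [hL, ← Finset.sum_neg_distrib]
  refine Finset.sum_congr rfl fun z _ => ?_
  rw [mul_kComm_apply _ _ hEs, res_mulVec, Function.comp_apply, neg_mul, neg_neg]

/-- off the cube the column vanishes. [cite: Balaban1984PropagatorsII, (2.38) p.229, dictionary] -/
theorem bX_transpose_mulVec_off (hP : ∀ μ, 1 ≤ P μ) (cq : ℕ × (Fin (d + 1) → ℤ)) (hc : B6Eq238MultiLevelBoxL0.CubeData D cq)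
    (f : ↥(boxDom (N0 ℓ Mh k P)) → ℝ) {x : ↥(boxDom (N0 ℓ Mh k P))}
    (hne : ∀ b, embC D hP cq hc b ≠ (castP (ℓ := ℓ) (Mh := Mh) (P := P) (fin_data hc).2.1 hc.hj.2).symm x) :
    ((bX D a c hP cq hc)ᵀ *ᵥ f) x = 0 := by
  rw [bX_eq, Matrix.transpose_reindex, reindex_mulVec_apply]
  unfold innerB
  rw [Matrix.transpose_mul, Matrix.transpose_mul, Matrix.transpose_transpose, ← Matrix.mulVec_mulVec,
    ← Matrix.mulVec_mulVec]
  exact transpose_res_mulVec_off _ _ hne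

/-- **THE MAJORANT OF `S = Λ^{−1}RᵀΛ` FOR THE GENUINE `k`-LEVEL OPERATOR**: there are `δ₄, K′ > 0` (functions of
`d`, `ℓ`, windows) such that for every `k`, `M_h ≥ 3`, `R ≥ 2L`, volume, nested family `D` and weights in the windows,
`S` has the majorant `(K′/M_h)·e^{−δ₄d(y,y′)/(d+1)}` — the columns of `R` are `O(1/M)` on the weighted `ℓ¹` (the three
terms of (2.40) with the rows and bond sums of `G′(□)`), and two sites of one cube have levels differing by at most one.
[cite: Balaban1984PropagatorsII, (2.44) p.230, (2.49)/(2.51) p.232, (2.64) p.234] -/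
theorem sOp_majorant (d ℓ : ℕ) (hℓ : 1 ≤ ℓ) (aminus aplus a2minus a2plus : ℝ) (ha : 0 < aminus) (ha2 : 0 < a2minus) :
    ∃ δ₄ K' : ℝ, 0 < δ₄ ∧ 0 < K' ∧ ∀ (k Mh R : ℕ), 3 ≤ Mh → 2 * (ℓ + 1) ≤ R →
      ∀ (P : Fin (d + 1) → ℕ) (hP : ∀ μ, 1 ≤ P μ) (D : Domains d ℓ Mh k P R) (a c : ℕ → ℝ),
        (∀ i, aminus ≤ a i ∧ a i ≤ aplus) → (∀ i, a2minus ≤ c i ∧ c i ≤ a2plus) →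
        HasMajorant (g := geom D) (blkOf D) (Matrix.toLin' (levW D (-1) * (rML D a c hP)ᵀ * levW D 1))
          (fun y y' => K' / Mh * Real.exp (-(δ₄ / (d + 1) * (geom D).dist y y'))) := by
  obtain ⟨δa, c', hδa, hc', h243⟩ := B6Ineq243TwoLevelBoxL0.ineq243_twoLevel_roww d ℓ hℓ aminus aplus 0 a2minus a2plus ha ha2
  obtain ⟨δb, cs, hδb, hcs, h243s⟩ := B6Ineq243AdjTwoLevelBoxL0.ineq243_twoLevel_dstar_roww d ℓ hℓ aminus aplus 0 a2minus a2plus ha ha2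
  have hD1 := D1_nonneg contDiff_hprof hasCompactSupport_hprof
  have hD2 := D2_nonneg contDiff_hprof hasCompactSupport_hprof
  obtain ⟨δ, hδdef⟩ : ∃ δ : ℝ, δ = min δa δb := ⟨_, rfl⟩
  have hδ0 : 0 < δ := by rw [hδdef]; exact lt_min hδa hδb
  have hδa' : δ ≤ δa := by rw [hδdef]; exact min_le_left _ _
  have hδb' : δ ≤ δb := by rw [hδdef]; exact min_le_right _ _
  have hL0 : (0 : ℝ) < (ℓ : ℝ) + 1 := by positivity
  have hL1 : (1 : ℝ) ≤ (ℓ : ℝ) + 1 := by linarith [(Nat.cast_nonneg ℓ : (0 : ℝ) ≤ ℓ)]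
  -- the `M`-free constants (as in `B6Prop22AdjTwoLevelBox.roww_transpose_rOp_le`)
  obtain ⟨A₁, hA₁⟩ : ∃ A₁ : ℝ, A₁ = (d + 1) * D1 hprof := ⟨_, rfl⟩
  obtain ⟨A₂, hA₂⟩ : ∃ A₂ : ℝ, A₂ = (d + 1) * D2 hprof := ⟨_, rfl⟩
  obtain ⟨ap, hap⟩ : ∃ ap : ℝ, ap = (|aplus| + |a2plus|) * ((ℓ : ℝ) + 1) * Real.exp (δ * ((ℓ : ℝ) + 1)) :=
    ⟨_, rfl⟩
  have hA₁0 : 0 ≤ A₁ := by rw [hA₁]; positivity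
  have hA₂0 : 0 ≤ A₂ := by rw [hA₂]; positivity
  have hap0 : 0 ≤ ap := by rw [hap]; positivity
  obtain ⟨CR₀, hCR₀⟩ : ∃ CR₀ : ℝ, CR₀ = A₁ * ((1 + Real.exp δ) * ((d + 1) * cs)) + (A₂ + ap * A₁) * c' := ⟨_, rfl⟩
  have hCR₀0 : 0 ≤ CR₀ := by rw [hCR₀]; positivity
  refine ⟨δ, 3 * 2 ^ (d + 1) * Real.exp δ * CR₀ + 1, hδ0, by positivity, ?_⟩
  intro k Mh R hMh hR P hP D a c haw hcw y' lam B hlam x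
  have hMh1 : 1 ≤ Mh := le_trans (by norm_num) hMh
  have hMh2 : 2 ≤ Mh := le_trans (by norm_num) hMh
  have hMhr : (1 : ℝ) ≤ Mh := by exact_mod_cast hMh1
  have hlamB : ∀ w, |lam w| ≤ B := fun w => BlockSupp.abs_le hlam w
  have hB0 : 0 ≤ B := hlam.nonneg
  obtain ⟨M, hM⟩ : ∃ M : ℝ, M = ((ℓ : ℝ) + 1) * Mh := ⟨_, rfl⟩
  have hM1 : (1 : ℝ) ≤ M := by rw [hM]; nlinarith
  have hMpos : 0 < M := by linarith
  rw [Matrix.toLin'_apply, ← Matrix.mulVec_mulVec, ← Matrix.mulVec_mulVec]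
  unfold levW
  rw [Matrix.mulVec_diagonal]
  set f : ↥(boxDom (N0 ℓ Mh k P)) → ℝ :=
    Matrix.diagonal (fun x : ↥(boxDom (N0 ℓ Mh k P)) => (((ℓ : ℝ) + 1) ^ D.lev x.1) ^ (1 : ℤ)) *ᵥ lam with hfdef
  have hf : ∀ z, f z = ((ℓ : ℝ) + 1) ^ D.lev z.1 * lam z := by
    intro z; rw [hfdef, Matrix.mulVec_diagonal, zpow_one]
  set dist0 : ℝ := (((bond D).dist (blkOf D x) y' : ℕ) : ℝ) with hdist0
  have hgeom : (geom D).dist (blkOf D x) y' = dist0 := rfl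
  have hdist0nn : 0 ≤ dist0 := by positivity
  -- the bound of one term `(bX_□ᵀ f)(x)`
  set E : ℝ := ((ℓ : ℝ) + 1) ^ (D.lev x.1 + 1) * (Real.exp δ * (CR₀ / M) * Real.exp (-(δ / (d + 1) * dist0)) * B)
    with hE
  have hE0 : 0 ≤ E := by positivity
  have hterm : ∀ (cq : ℕ × (Fin (d + 1) → ℤ)) (hc : CubeData D cq), |((bX D a c hP cq hc)ᵀ *ᵥ f) x| ≤ E := by
    intro cq hc
    obtain ⟨-, hij, hji, -, -⟩ := fin_data hc
    have hjk := hc.hj.2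
    by_cases himg : ∃ b, embC D hP cq hc b = (castP (ℓ := ℓ) (Mh := Mh) (P := P) hij hjk).symm x
    swap
    · push Not at himg
      rw [bX_transpose_mulVec_off hP cq hc f himg, abs_zero]; exact hE0
    obtain ⟨b, hb⟩ := himg
    rw [bX_transpose_mulVec_img hP cq hc f hb, abs_mul]
    -- the cube data
    have hzval : ∀ w : ↥(boxDom (N0 ℓ Mh k P)), ((castP (ℓ := ℓ) (Mh := Mh) (P := P) hij hjk).symm w).1 = w.1 :=
      fun w => by unfold castP; exact boxCast_symm_apply_val _ _
    have hbx : (embC D hP cq hc b).1 = x.1 := by rw [hb, hzval]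
    have hxin : InCube ℓ Mh k P cq.1 cq.2 x.1 := by
      rw [← hzval x]; exact (inCube_iff_exists_emb (Mh := Mh) hP hij hc.hq _).2 ⟨b, hb⟩
    have hlevwin := lev_window_of_inCube hℓ hR hP hMh2 hc x.2 hxin
    have hMh' : 1 ≤ MhP ℓ Mh cq.1 (fin D cq.1 cq.2) := one_le_MhP hMh1 _ _
    have hMhle : Mh ≤ MhP ℓ Mh cq.1 (fin D cq.1 cq.2) := by
      unfold MhP; exact Nat.le_mul_of_pos_right _ (Nat.one_le_pow _ _ (by omega))
    have hcM' : ∀ ν, 1 ≤ cubeM' (MhP ℓ Mh cq.1 (fin D cq.1 cq.2)) (Pj ℓ k P cq.1) cq.2 ν := fun ν =>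
      Nat.one_le_iff_ne_zero.2 (Nat.mul_ne_zero_iff.2
        ⟨by omega, by have := (one_le_cubeW (one_le_Pj hP cq.1) hc.hq ν).1; omega⟩)
    have hn1 : 1 ≤ (ℓ + 1) ^ fin D cq.1 cq.2 := Nat.one_le_pow _ _ (by omega)
    have hn : (0 : ℝ) < (((ℓ + 1) ^ fin D cq.1 cq.2 : ℕ) : ℝ) := by positivity
    have haj : 0 < a (fin D cq.1 cq.2) := lt_of_lt_of_le ha (haw _).1
    have ha0 : 0 ≤ c (fin D cq.1 cq.2) := (lt_of_lt_of_le ha2 (hcw _).1).le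
    set Dd : ℝ := (((ℓ + 1) ^ fin D cq.1 cq.2 : ℕ) : ℝ) * (dist0 / (d + 1) - 1) with hDd
    -- `|v_□| ≤ 1`
    have hw : |((fun z => vFun D cq.1 cq.2 z.1) ∘ embC D hP cq hc) b| ≤ 1 := abs_vFun_le_one _ _ _
    -- the weighted `ℓ¹` of the column: the three terms of (2.40)
    obtain ⟨M', hM'⟩ : ∃ M' : ℝ, M' = ((ℓ : ℝ) + 1) * (MhP ℓ Mh cq.1 (fin D cq.1 cq.2) : ℝ) := ⟨_, rfl⟩
    have hMM' : M ≤ M' := by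
      rw [hM, hM']; exact mul_le_mul_of_nonneg_left (by exact_mod_cast hMhle) hL0.le
    have hM'pos : 0 < M' := lt_of_lt_of_le hMpos hMM'
    obtain ⟨κ₁, hκ₁⟩ : ∃ κ₁ : ℝ, κ₁ = A₁ / M' := ⟨_, rfl⟩
    obtain ⟨κ₂, hκ₂⟩ : ∃ κ₂ : ℝ, κ₂ = (d + 1) * (D2 hprof / M' ^ 2) := ⟨_, rfl⟩
    have hκ₁0 : 0 ≤ κ₁ := by rw [hκ₁]; positivity
    have hκ₂0 : 0 ≤ κ₂ := by rw [hκ₂]; positivity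
    have hK := wsum_kComm_le hn1 haj ha0 (m2 := 0) (κ₂ := κ₂)
      (isBlockUnion_lamLoc (one_le_Pj hP cq.1) hc.hq (isBlockUnion_LamG (D := D) hij hjk)) hδ0.le hκ₁0
      (hLoc ℓ (fin D cq.1 cq.2) (MhP ℓ Mh cq.1 (fin D cq.1 cq.2)) (Pj ℓ k P cq.1) cq.2)
      (fun z z' => by rw [hκ₁, hA₁, hM']; exact hLoc_lipschitz hMh' cq.2 z z')
      (fun z => by rw [hκ₂, hM']; exact hLoc_laplacian_le' hℓ (show 2 ≤ MhP ℓ Mh cq.1 (fin D cq.1 cq.2) from le_trans hMh2 (Nat.le_mul_of_pos_right _ (by positivity))) (one_le_Pj hP cq.1) hc.hq z)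
      (fun z' => cG D a c cq.1 (fin D cq.1 cq.2) cq.2 hP hc.hq b z') b
    have hsumGD : ∑ μ : Fin (d + 1), wsum δ ((ℓ + 1) ^ fin D cq.1 cq.2) b (fun z => ((((ℓ + 1) ^ fin D cq.1 cq.2 : ℕ)) : ℝ)
        * (cG D a c cq.1 (fin D cq.1 cq.2) cq.2 hP hc.hq b (fwd _ μ z) - cG D a c cq.1 (fin D cq.1 cq.2) cq.2 hP hc.hq b z))
        ≤ (d + 1) * cs := by
      calc ∑ μ : Fin (d + 1), wsum δ ((ℓ + 1) ^ fin D cq.1 cq.2) b (fun z => ((((ℓ + 1) ^ fin D cq.1 cq.2 : ℕ)) : ℝ)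
            * (cG D a c cq.1 (fin D cq.1 cq.2) cq.2 hP hc.hq b (fwd _ μ z) - cG D a c cq.1 (fin D cq.1 cq.2) cq.2 hP hc.hq b z))
          ≤ ∑ _μ : Fin (d + 1), cs := Finset.sum_le_sum fun μ _ => by
            have := (roww_mono hδb' _ _ _).trans (h243s (fin D cq.1 cq.2) (a (fin D cq.1 cq.2)) 0
              (c (fin D cq.1 cq.2)) (haw _).1 (haw _).2 le_rfl le_rfl (hcw _).1 (hcw _).2 _ hcM'
              (lamLoc ℓ (MhP ℓ Mh cq.1 (fin D cq.1 cq.2)) (Pj ℓ k P cq.1) cq.2 (one_le_Pj hP cq.1) hc.hq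
                (LamG D cq.1 (fin D cq.1 cq.2))) μ b)
            rw [roww_dstar] at this
            exact this
        _ = (d + 1) * cs := by
            rw [Finset.sum_const, Finset.card_univ, Fintype.card_fin, nsmul_eq_mul]; push_cast; ring
    have hG0 : wsum δ ((ℓ + 1) ^ fin D cq.1 cq.2) b (fun z' => cG D a c cq.1 (fin D cq.1 cq.2) cq.2 hP hc.hq b z') ≤ c' :=
      (roww_mono hδa' _ _ _).trans (h243 (fin D cq.1 cq.2) (a (fin D cq.1 cq.2)) 0 (c (fin D cq.1 cq.2))
        (haw _).1 (haw _).2 le_rfl le_rfl (hcw _).1 (hcw _).2 _ hcM' _ b)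
    have hco : 0 ≤ κ₂ + (a (fin D cq.1 cq.2) + c (fin D cq.1 cq.2)) * ((ℓ : ℝ) + 1) * Real.exp (δ * ((ℓ : ℝ) + 1)) * κ₁ := by
      positivity
    have hwsum : wsum δ ((ℓ + 1) ^ fin D cq.1 cq.2) b
        (fun z => (kComm (cOp D a c cq.1 (fin D cq.1 cq.2) cq.2 hP hc.hq)
          (hLoc ℓ (fin D cq.1 cq.2) (MhP ℓ Mh cq.1 (fin D cq.1 cq.2)) (Pj ℓ k P cq.1) cq.2)
          *ᵥ (fun z' => cG D a c cq.1 (fin D cq.1 cq.2) cq.2 hP hc.hq b z')) z) ≤ CR₀ / M := by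
      have t1 := mul_le_mul_of_nonneg_left hsumGD (mul_nonneg hκ₁0 (by positivity : (0 : ℝ) ≤ 1 + Real.exp δ))
      have t2 := mul_le_mul_of_nonneg_left hG0 hco
      refine (hK.trans (add_le_add t1 t2)).trans ?_
      -- sizes: `κ₁ ≤ A₁/M`, `κ₂ ≤ A₂/M`, `a + c ≤ |a₊| + |c₊|`
      have hκ₁' : κ₁ ≤ A₁ / M := by rw [hκ₁]; exact div_le_div_of_nonneg_left hA₁0 hMpos hMM'
      have hκ₂' : κ₂ ≤ A₂ / M := by
        rw [hκ₂, hA₂]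
        have hM'1 : (1 : ℝ) ≤ M' := hM1.trans hMM'
        have hM2 : D2 hprof / M' ^ 2 ≤ D2 hprof / M := by
          apply div_le_div_of_nonneg_left hD2 hMpos
          calc M ≤ M' := hMM'
            _ = M' * 1 := (mul_one _).symm
            _ ≤ M' * M' := mul_le_mul_of_nonneg_left hM'1 hM'pos.le
            _ = M' ^ 2 := (sq _).symm
        calc ((d : ℝ) + 1) * (D2 hprof / M' ^ 2) ≤ (d + 1) * (D2 hprof / M) :=
              mul_le_mul_of_nonneg_left hM2 (by positivity)
          _ = (d + 1) * D2 hprof / M := mul_div_assoc' _ _ _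
      have hajp : (a (fin D cq.1 cq.2) + c (fin D cq.1 cq.2)) * ((ℓ : ℝ) + 1) * Real.exp (δ * ((ℓ : ℝ) + 1)) ≤ ap := by
        rw [hap]
        have : a (fin D cq.1 cq.2) + c (fin D cq.1 cq.2) ≤ |aplus| + |a2plus| :=
          add_le_add ((haw _).2.trans (le_abs_self _)) ((hcw _).2.trans (le_abs_self _))
        exact mul_le_mul_of_nonneg_right (mul_le_mul_of_nonneg_right this hL0.le) (Real.exp_pos _).le
      have h1 : (κ₂ + (a (fin D cq.1 cq.2) + c (fin D cq.1 cq.2)) * ((ℓ : ℝ) + 1) * Real.exp (δ * ((ℓ : ℝ) + 1)) * κ₁) * c'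
          ≤ (A₂ / M + ap * (A₁ / M)) * c' :=
        mul_le_mul_of_nonneg_right (add_le_add hκ₂' (mul_le_mul hajp hκ₁' hκ₁0 hap0)) hc'.le
      have h0 : κ₁ * (1 + Real.exp δ) * ((d + 1) * cs) ≤ A₁ / M * (1 + Real.exp δ) * ((d + 1) * cs) :=
        mul_le_mul_of_nonneg_right (mul_le_mul_of_nonneg_right hκ₁' (by positivity)) (by positivity)
      have h2 : A₁ / M * (1 + Real.exp δ) * ((d + 1) * cs) + (A₂ / M + ap * (A₁ / M)) * c' = CR₀ / M := by
        rw [hCR₀]; field_simp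
      rw [← h2]
      exact add_le_add h0 h1
    -- the vector `z ↦ f(□-image of z)`: bound `L^{lev x + 1}·B` and support distance `Dd`
    have hF : ∀ z, |f (castP (fin_data hc).2.1 hc.hj.2 (embC D hP cq hc z))| ≤ ((ℓ : ℝ) + 1) ^ (D.lev x.1 + 1) * B := by
      intro z
      rw [hf, abs_mul, abs_of_nonneg (by positivity)]
      set x'' : ↥(boxDom (N0 ℓ Mh k P)) := castP (fin_data hc).2.1 hc.hj.2 (embC D hP cq hc z) with hx''
      have hx''val : x''.1 = (embC D hP cq hc z).1 := by rw [hx'']; unfold castP; exact boxCast_apply_val _ _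
      have hx''in : InCube ℓ Mh k P cq.1 cq.2 x''.1 := by
        rw [hx''val]; exact (inCube_iff_exists_emb (Mh := Mh) hP hij hc.hq _).2 ⟨z, rfl⟩
      have hlev'' := lev_window_of_inCube hℓ hR hP hMh2 hc x''.2 hx''in
      have hpow : ((ℓ : ℝ) + 1) ^ D.lev x''.1 ≤ ((ℓ : ℝ) + 1) ^ (D.lev x.1 + 1) :=
        pow_le_pow_right₀ hL1 (by omega)
      exact mul_le_mul hpow (hlamB _) (abs_nonneg _) (by positivity)
    have hD : ∀ z, f (castP (fin_data hc).2.1 hc.hj.2 (embC D hP cq hc z)) ≠ 0 → Dd ≤ supNorm (b.1 - z.1) := by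
      intro z hz
      set x'' : ↥(boxDom (N0 ℓ Mh k P)) := castP (fin_data hc).2.1 hc.hj.2 (embC D hP cq hc z) with hx''
      have hμx : lam x'' ≠ 0 := by
        intro h0; apply hz; rw [hf, h0, mul_zero]
      have hx''val : x''.1 = (embC D hP cq hc z).1 := by rw [hx'']; unfold castP; exact boxCast_apply_val _ _
      have hx''in : InCube ℓ Mh k P cq.1 cq.2 x''.1 := by
        rw [hx''val]; exact (inCube_iff_exists_emb (Mh := Mh) hP hij hc.hq _).2 ⟨z, rfl⟩
      have hblk : blkOf D x'' = y' := by
        by_contra hne; exact hμx (hlam.off x'' hne)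
      have h := Dd_le_supNorm hℓ hR hP hMh2 hc x x'' hxin hx''in y' hblk
      have hsub : x.1 - x''.1 = b.1 - z.1 := by
        rw [hx''val, ← hbx]; unfold embC; exact emb_sub_emb _ hc.hq b z
      rw [hsub] at h
      exact h
    have hcol := sum_mul_le_of_wrow hn (by positivity)
      (fun z => (kComm (cOp D a c cq.1 (fin D cq.1 cq.2) cq.2 hP hc.hq)
          (hLoc ℓ (fin D cq.1 cq.2) (MhP ℓ Mh cq.1 (fin D cq.1 cq.2)) (Pj ℓ k P cq.1) cq.2)
          *ᵥ (fun z' => cG D a c cq.1 (fin D cq.1 cq.2) cq.2 hP hc.hq b z')) z)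
      (fun z => f (castP (fin_data hc).2.1 hc.hj.2 (embC D hP cq hc z)))
      (fun z => supNorm (b.1 - z.1)) hwsum hF hD hδ0.le
    have hexp : Real.exp (-(δ * Dd / (((ℓ + 1) ^ fin D cq.1 cq.2 : ℕ) : ℝ)))
        = Real.exp δ * Real.exp (-(δ / (d + 1) * dist0)) := by rw [hDd]; exact exp_Dd_eq hn d
    rw [hexp] at hcol
    rw [hE]
    calc |((fun z => vFun D cq.1 cq.2 z.1) ∘ embC D hP cq hc) b|
          * |∑ z, (kComm (cOp D a c cq.1 (fin D cq.1 cq.2) cq.2 hP hc.hq)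
              (hLoc ℓ (fin D cq.1 cq.2) (MhP ℓ Mh cq.1 (fin D cq.1 cq.2)) (Pj ℓ k P cq.1) cq.2)
              *ᵥ (fun z' => cG D a c cq.1 (fin D cq.1 cq.2) cq.2 hP hc.hq b z')) z
              * f (castP (fin_data hc).2.1 hc.hj.2 (embC D hP cq hc z))|
        ≤ 1 * (CR₀ / M * (Real.exp δ * Real.exp (-(δ / (d + 1) * dist0))) * (((ℓ : ℝ) + 1) ^ (D.lev x.1 + 1) * B)) :=
          mul_le_mul hw hcol (abs_nonneg _) zero_le_one
      _ = ((ℓ : ℝ) + 1) ^ (D.lev x.1 + 1) * (Real.exp δ * (CR₀ / M) * Real.exp (-(δ / (d + 1) * dist0)) * B) := by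
          ring
  -- summing over the cover: only members with `v_□(x) ≠ 0`
  rw [abs_mul]
  have hpow : |((((ℓ : ℝ) + 1) ^ D.lev x.1) ^ (-1 : ℤ))| = (((ℓ : ℝ) + 1) ^ D.lev x.1)⁻¹ := by
    rw [_root_.zpow_neg_one, abs_of_nonneg (by positivity)]
  rw [hpow]
  unfold rML
  rw [Matrix.transpose_sum, Matrix.sum_mulVec, Finset.sum_apply, Finset.attach_eq_univ]
  have key := sum_le_card_mul
    (fun cq : {cq // cq ∈ cubeSet D} => |((bX D a c hP cq.1 (cubeData_of_mem cq.2))ᵀ *ᵥ f) x|)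
    (fun cq => cq.1) Subtype.val_injective (keySet ℓ Mh (D.lev x.1) x.1)
    (fun cq hq0 => by
      by_contra hmem
      apply hq0
      obtain ⟨-, hij, hji, -, -⟩ := fin_data (cubeData_of_mem cq.2)
      by_cases himg : ∃ b, embC D hP cq.1 (cubeData_of_mem cq.2) b
          = (castP (ℓ := ℓ) (Mh := Mh) (P := P) hij (cubeData_of_mem cq.2).hj.2).symm x
      · obtain ⟨b, hb⟩ := himg
        rw [bX_transpose_mulVec_img hP cq.1 _ f hb]
        have hux : uX (ℓ := ℓ) (Mh := Mh) (k := k) (P := P) cq.1 x = 0 := by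
          by_contra h
          exact hmem (mem_keySet_of_uX_ne_zero hℓ hR hP hMh2 cq.1 (cubeData_of_mem cq.2) h)
        have hbx : (embC D hP cq.1 (cubeData_of_mem cq.2) b).1 = x.1 := by
          rw [hb]; unfold castP; exact boxCast_symm_apply_val _ _
        have hv : ((fun z => vFun D cq.1.1 cq.1.2 z.1) ∘ embC D hP cq.1 (cubeData_of_mem cq.2)) b = 0 := by
          have hux' : uFun ℓ Mh cq.1.1 cq.1.2 x.1 = 0 := hux
          simp only [Function.comp_apply]
          unfold vFun
          rw [hbx, hux', zero_mul]
        rw [hv, zero_mul, abs_zero]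
      · push Not at himg
        rw [bX_transpose_mulVec_off hP cq.1 _ f himg, abs_zero])
    hE0 (fun cq => hterm cq.1 (cubeData_of_mem cq.2))
  refine (mul_le_mul_of_nonneg_left ((Finset.abs_sum_le_sum_abs _ _).trans key) (by positivity)).trans ?_
  have hcard : ((keySet ℓ Mh (D.lev x.1) x.1).card : ℝ) ≤ 3 * 2 ^ (d + 1) := by
    exact_mod_cast card_keySet_le _ _ _ _
  dsimp only
  rw [hgeom]
  have hLM : ((ℓ : ℝ) + 1) / M = 1 / Mh := by rw [hM, div_mul_eq_div_div, div_self hL0.ne']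
  have hrest : 0 ≤ Real.exp (-(δ / (d + 1) * dist0)) * B := by positivity
  have hMh0 : (0 : ℝ) < Mh := by linarith
  calc (((ℓ : ℝ) + 1) ^ D.lev x.1)⁻¹ * (((keySet ℓ Mh (D.lev x.1) x.1).card : ℝ) * E)
      ≤ (((ℓ : ℝ) + 1) ^ D.lev x.1)⁻¹ * (3 * 2 ^ (d + 1) * E) :=
        mul_le_mul_of_nonneg_left (mul_le_mul_of_nonneg_right hcard hE0) (by positivity)
    _ = 3 * 2 ^ (d + 1) * Real.exp δ * CR₀ * (((ℓ : ℝ) + 1) / M) * (Real.exp (-(δ / (d + 1) * dist0)) * B) := by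
        rw [hE]
        field_simp
        ring
    _ = 3 * 2 ^ (d + 1) * Real.exp δ * CR₀ / Mh * (Real.exp (-(δ / (d + 1) * dist0)) * B) := by
        rw [hLM]; ring
    _ ≤ (3 * 2 ^ (d + 1) * Real.exp δ * CR₀ + 1) / Mh * (Real.exp (-(δ / (d + 1) * dist0)) * B) :=
        mul_le_mul_of_nonneg_right (div_le_div_of_nonneg_right (by linarith) hMh0.le) hrest
    _ = (3 * 2 ^ (d + 1) * Real.exp δ * CR₀ + 1) / Mh * Real.exp (-(δ / (d + 1) * dist0)) * B := by ring

end SMajorant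

/-! ## §4 The majorant of `T̃₀ = Λ^{−1}G′₀ᵀ∂ᵀ` -/

section TZeroMajorant

variable {ℓ Mh k R : ℕ} {P : Fin (d + 1) → ℕ} {D : Domains d ℓ Mh k P R} {a c : ℕ → ℝ}

/-- `(M·e_{x′})(x) = M(x,x′)`. [folklore] -/
private theorem mulVec_single_one_apply {X : Type*} [Fintype X] [DecidableEq X] (M : Matrix X X ℝ) (x x' : X) :
    (M *ᵥ Pi.single x' (1 : ℝ)) x = M x x' := by
  simp [Matrix.mulVec, dotProduct, Pi.single_apply]

/-- a sum over the box of a function vanishing off the cube image is the sum over the cube. [folklore] -/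
private theorem sum_eq_sum_cube (hP : ∀ μ, 1 ≤ P μ) (cq : ℕ × (Fin (d + 1) → ℤ)) (hc : CubeData D cq)
    (Φ : ↥(boxDom (N0 ℓ Mh k P)) → ℝ)
    (h0 : ∀ x', (∀ b, castP (fin_data hc).2.1 hc.hj.2 (embC D hP cq hc b) ≠ x') → Φ x' = 0) :
    ∑ x', Φ x' = ∑ b, Φ (castP (fin_data hc).2.1 hc.hj.2 (embC D hP cq hc b)) := by
  classical
  have hinj : Function.Injective (fun b => castP (fin_data hc).2.1 hc.hj.2 (embC D hP cq hc b)) :=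
    fun b b' h => emb_injective _ hc.hq ((castP (fin_data hc).2.1 hc.hj.2).injective h)
  rw [← Finset.sum_image (f := Φ) (fun b _ b' _ h => hinj h)]
  symm
  refine Finset.sum_subset (Finset.subset_univ _) fun x' _ hx' => h0 x' fun b hb => hx' ?_
  exact Finset.mem_image.2 ⟨b, Finset.mem_univ _, hb⟩

/-- **ENTRIES OF `G′(□)` ON THE REFERENCE PRESENTATION**: `L^{2i_□}·G′(□)(y, b)` between two sites of the cube image.
[cite: Balaban1984PropagatorsII, (2.37) p.229, (2.42) p.230, dictionary] -/
theorem gX_apply_img (hP : ∀ μ, 1 ≤ P μ) (cq : ℕ × (Fin (d + 1) → ℤ)) (hc : B6Eq238MultiLevelBoxL0.CubeData D cq)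
    {x x' : ↥(boxDom (N0 ℓ Mh k P))}
    {y b : ↥(Box d ℓ (fin D cq.1 cq.2)
      (fun μ => (ℓ + 1) * cubeM' (MhP ℓ Mh cq.1 (fin D cq.1 cq.2)) (Pj ℓ k P cq.1) cq.2 μ))}
    (hy : embC D hP cq hc y = (castP (ℓ := ℓ) (Mh := Mh) (P := P) (fin_data hc).2.1 hc.hj.2).symm x)
    (hb : embC D hP cq hc b = (castP (ℓ := ℓ) (Mh := Mh) (P := P) (fin_data hc).2.1 hc.hj.2).symm x') :
    gX D a c hP cq hc x x' = ((((ℓ : ℝ) + 1)) ^ fin D cq.1 cq.2) ^ 2 * cG D a c cq.1 (fin D cq.1 cq.2) cq.2 hP hc.hq y b := by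
  classical
  have hinj : Function.Injective (embC D hP cq hc) := emb_injective _ hc.hq
  rw [← mulVec_single_one_apply (gX D a c hP cq hc) x x', gX_row_img hP cq hc _ hy]
  congr 1
  set w := res (embC D hP cq hc) *ᵥ (Pi.single x' (1 : ℝ) ∘ castP (fin_data hc).2.1 hc.hj.2) with hw
  have hwb : ∀ b', w b' = if b' = b then 1 else 0 := by
    intro b'
    rw [hw, res_mulVec, Function.comp_apply, Pi.single_apply]
    by_cases h : b' = b
    · rw [if_pos h, if_pos]
      rw [h, hb, Equiv.apply_symm_apply]
    · rw [if_neg h, if_neg]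
      intro h'
      apply h
      apply hinj
      rw [hb, ← h', Equiv.symm_apply_apply]
  simp only [Matrix.mulVec, dotProduct, hwb, mul_ite, mul_one, mul_zero, Finset.sum_ite_eq', Finset.mem_univ,
    if_true]

/-- off the cube image the entries vanish. [cite: Balaban1984PropagatorsII, (2.37) p.229, dictionary] -/
theorem gX_apply_off (hP : ∀ μ, 1 ≤ P μ) (cq : ℕ × (Fin (d + 1) → ℤ)) (hc : B6Eq238MultiLevelBoxL0.CubeData D cq)
    {x x' : ↥(boxDom (N0 ℓ Mh k P))}
    (hne : ∀ b, embC D hP cq hc b ≠ (castP (ℓ := ℓ) (Mh := Mh) (P := P) (fin_data hc).2.1 hc.hj.2).symm x') :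
    gX D a c hP cq hc x x' = 0 := by
  classical
  by_cases hx : ∃ y, embC D hP cq hc y = (castP (ℓ := ℓ) (Mh := Mh) (P := P) (fin_data hc).2.1 hc.hj.2).symm x
  · obtain ⟨y, hy⟩ := hx
    rw [← mulVec_single_one_apply (gX D a c hP cq hc) x x', gX_row_img hP cq hc _ hy]
    set w := res (embC D hP cq hc) *ᵥ (Pi.single x' (1 : ℝ) ∘ castP (fin_data hc).2.1 hc.hj.2) with hw
    have hwb : ∀ b', w b' = 0 := by
      intro b'
      rw [hw, res_mulVec, Function.comp_apply, Pi.single_apply, if_neg]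
      intro h
      exact hne b' (by rw [← h, Equiv.symm_apply_apply])
    simp only [Matrix.mulVec, dotProduct, hwb, mul_zero, Finset.sum_const_zero]
  · push Not at hx
    rw [← mulVec_single_one_apply (gX D a c hP cq hc) x x', gX_row_off hP cq hc _ hx]

/-- `G′(□)` on the reference presentation is symmetric. [cite: Balaban1984PropagatorsII, (2.37) p.229, (2.42) p.230] -/
theorem gX_symm (hP : ∀ μ, 1 ≤ P μ) (cq : ℕ × (Fin (d + 1) → ℤ)) (hc : B6Eq238MultiLevelBoxL0.CubeData D cq)
    (x x' : ↥(boxDom (N0 ℓ Mh k P))) : gX D a c hP cq hc x' x = gX D a c hP cq hc x x' := by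
  have hGs : (cG D a c cq.1 (fin D cq.1 cq.2) cq.2 hP hc.hq)ᵀ = cG D a c cq.1 (fin D cq.1 cq.2) cq.2 hP hc.hq :=
    (gTwoLevel_isSymm _ _ _ _ _ _ _).eq
  have hT : (gX D a c hP cq hc)ᵀ = gX D a c hP cq hc := by
    unfold gX
    rw [Matrix.transpose_reindex, Matrix.transpose_mul, Matrix.transpose_mul, Matrix.transpose_transpose,
      Matrix.transpose_smul, hGs, ← Matrix.mul_assoc]
  have h := congrFun (congrFun hT x) x'
  rw [Matrix.transpose_apply] at h
  exact h

/-- **THE ENTRIES OF A TERM OF `G′₀ᵀ∂ᵀ`** (product rule on the column):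
`(v_□G′(□)h_□·∂ᵀ)(x, x′) = v_□(x)·[(h_□(x′+e) − h_□(x′))·G′(□)(x,x′) + h_□(x′+e)·(G′(□)(x,x′+e) − G′(□)(x,x′))]`.
[cite: Balaban1984PropagatorsII, (2.37) p.229, (2.67) p.234 (third entry), dictionary] -/
theorem aXt_dMatt_apply (hP : ∀ μ, 1 ≤ P μ) (cq : ℕ × (Fin (d + 1) → ℤ)) (hc : B6Eq238MultiLevelBoxL0.CubeData D cq) (μ : Fin (d + 1))
    (x x' : ↥(boxDom (N0 ℓ Mh k P))) (hxe : x'.1 + Pi.single μ 1 ∈ boxDom (N0 ℓ Mh k P)) :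
    ((aX D a c hP cq hc)ᵀ * (dMat (N0 ℓ Mh k P) μ)ᵀ) x x'
      = vX D cq x * ((uX (ℓ := ℓ) (Mh := Mh) (k := k) (P := P) cq ⟨x'.1 + Pi.single μ 1, hxe⟩
            - uX (ℓ := ℓ) (Mh := Mh) (k := k) (P := P) cq x') * gX D a c hP cq hc x x'
          + uX (ℓ := ℓ) (Mh := Mh) (k := k) (P := P) cq ⟨x'.1 + Pi.single μ 1, hxe⟩
            * (gX D a c hP cq hc x ⟨x'.1 + Pi.single μ 1, hxe⟩ - gX D a c hP cq hc x x')) := by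
  have hcol : ((aX D a c hP cq hc)ᵀ * (dMat (N0 ℓ Mh k P) μ)ᵀ) x x'
      = (dMat (N0 ℓ Mh k P) μ *ᵥ (fun w => aX D a c hP cq hc w x)) x' := by
    simp only [Matrix.mul_apply, Matrix.transpose_apply, Matrix.mulVec, dotProduct]
    exact Finset.sum_congr rfl fun w _ => mul_comm _ _
  have haX : ∀ w, aX D a c hP cq hc w x = uX (ℓ := ℓ) (Mh := Mh) (k := k) (P := P) cq w * gX D a c hP cq hc x w
      * vX D cq x := by
    intro w
    unfold aX
    rw [Matrix.mul_diagonal, Matrix.diagonal_mul, gX_symm hP cq hc x w]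
  rw [hcol, dMat_mulVec_of_mem μ hxe, haX, haX]
  ring

/-- and they vanish where `x′ + e_μ` leaves the box. [cite: Balaban1984PropagatorsII, (2.67) p.234, dictionary] -/
theorem aXt_dMatt_apply_off (hP : ∀ μ, 1 ≤ P μ) (cq : ℕ × (Fin (d + 1) → ℤ)) (hc : B6Eq238MultiLevelBoxL0.CubeData D cq)
    (μ : Fin (d + 1)) (x x' : ↥(boxDom (N0 ℓ Mh k P))) (hxe : x'.1 + Pi.single μ 1 ∉ boxDom (N0 ℓ Mh k P)) :
    ((aX D a c hP cq hc)ᵀ * (dMat (N0 ℓ Mh k P) μ)ᵀ) x x' = 0 := by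
  have hcol : ((aX D a c hP cq hc)ᵀ * (dMat (N0 ℓ Mh k P) μ)ᵀ) x x'
      = (dMat (N0 ℓ Mh k P) μ *ᵥ (fun w => aX D a c hP cq hc w x)) x' := by
    simp only [Matrix.mul_apply, Matrix.transpose_apply, Matrix.mulVec, dotProduct]
    exact Finset.sum_congr rfl fun w _ => mul_comm _ _
  rw [hcol, dMat_mulVec_of_not_mem μ hxe]

/-- **THE MAJORANT OF `T̃₀ = Λ^{−1}G′₀ᵀ∂_μᵀ` FOR THE GENUINE `k`-LEVEL OPERATOR**: there are `δ₅, A > 0` (functions of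
`d`, `ℓ`, windows) such that for every `k`, `M_h ≥ 3`, `R ≥ 2L`, volume, nested family `D`, weights in the windows
and axis `μ`, `T̃₀` has the majorant `A·e^{−δ₅d(y,y′)/(d+1)}` — per term by the product rule on the column, the bond
sums of `G′(□)∂*` and the rows of `G′(□)` times `|∂h_□| ≤ (d+1)D₁/L^{j_□}`, with `L^{2i_□}/(L^{j_□}L^{j(x)}) ≤ 1`,
`L^{i_□}/L^{j(x)} ≤ 1`. [cite: Balaban1984PropagatorsII, (2.66)–(2.67) p.234 (third entry), (2.43) p.230] -/
theorem tZero_majorant (d ℓ : ℕ) (hℓ : 1 ≤ ℓ) (aminus aplus a2minus a2plus : ℝ) (ha : 0 < aminus)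
    (ha2 : 0 < a2minus) :
    ∃ δ₅ A : ℝ, 0 < δ₅ ∧ 0 < A ∧ ∀ (k Mh R : ℕ), 3 ≤ Mh → 2 * (ℓ + 1) ≤ R →
      ∀ (P : Fin (d + 1) → ℕ) (hP : ∀ μ, 1 ≤ P μ) (D : Domains d ℓ Mh k P R) (a c : ℕ → ℝ),
        (∀ i, aminus ≤ a i ∧ a i ≤ aplus) → (∀ i, a2minus ≤ c i ∧ c i ≤ a2plus) →
        ∀ μ : Fin (d + 1),
        HasMajorant (g := geom D) (blkOf D)
          (Matrix.toLin' (levW D (-1) * (gZeroML D a c hP)ᵀ * (dMat (N0 ℓ Mh k P) μ)ᵀ))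
          (fun y y' => A * Real.exp (-(δ₅ / (d + 1) * (geom D).dist y y'))) := by
  obtain ⟨δa, c', hδa, hc', h243⟩ := B6Ineq243TwoLevelBoxL0.ineq243_twoLevel_roww d ℓ hℓ aminus aplus 0 a2minus a2plus ha ha2
  obtain ⟨δb, cs, hδb, hcs, h243s⟩ := B6Ineq243AdjTwoLevelBoxL0.ineq243_twoLevel_dstar_roww d ℓ hℓ aminus aplus 0 a2minus a2plus ha ha2
  have hD1 := D1_nonneg contDiff_hprof hasCompactSupport_hprof
  obtain ⟨δ, hδdef⟩ : ∃ δ : ℝ, δ = min δa δb := ⟨_, rfl⟩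
  have hδ0 : 0 < δ := by rw [hδdef]; exact lt_min hδa hδb
  have hδa' : δ ≤ δa := by rw [hδdef]; exact min_le_left _ _
  have hδb' : δ ≤ δb := by rw [hδdef]; exact min_le_right _ _
  have hL0 : (0 : ℝ) < (ℓ : ℝ) + 1 := by positivity
  have hL1 : (1 : ℝ) ≤ (ℓ : ℝ) + 1 := by linarith [(Nat.cast_nonneg ℓ : (0 : ℝ) ≤ ℓ)]
  obtain ⟨Q, hQ⟩ : ∃ Q : ℝ, Q = ((d + 1) * D1 hprof * c' + cs) * Real.exp δ := ⟨_, rfl⟩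
  have hQ0 : 0 ≤ Q := by rw [hQ]; positivity
  refine ⟨δ, 3 * 2 ^ (d + 1) * Q + 1, hδ0, by positivity, ?_⟩
  intro k Mh R hMh hR P hP D a c haw hcw μ y' lam B hlam x
  have hMh1 : 1 ≤ Mh := le_trans (by norm_num) hMh
  have hMh2 : 2 ≤ Mh := le_trans (by norm_num) hMh
  have hlamB : ∀ w, |lam w| ≤ B := fun w => BlockSupp.abs_le hlam w
  have hB0 : 0 ≤ B := hlam.nonneg
  rw [Matrix.toLin'_apply, Matrix.mul_assoc, ← Matrix.mulVec_mulVec]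
  unfold levW
  rw [Matrix.mulVec_diagonal, abs_mul]
  have hpow : |((((ℓ : ℝ) + 1) ^ D.lev x.1) ^ (-1 : ℤ))| = (((ℓ : ℝ) + 1) ^ D.lev x.1)⁻¹ := by
    rw [_root_.zpow_neg_one, abs_of_nonneg (by positivity)]
  rw [hpow]
  set dist0 : ℝ := (((bond D).dist (blkOf D x) y' : ℕ) : ℝ) with hdist0
  have hgeom : (geom D).dist (blkOf D x) y' = dist0 := rfl
  have hdist0nn : 0 ≤ dist0 := by positivity
  -- one term
  set E : ℝ := ((ℓ : ℝ) + 1) ^ D.lev x.1 * (Q * Real.exp (-(δ / (d + 1) * dist0)) * B) with hE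
  have hE0 : 0 ≤ E := by positivity
  have hterm : ∀ (cq : ℕ × (Fin (d + 1) → ℤ)) (hc : CubeData D cq),
      |(((aX D a c hP cq hc)ᵀ * (dMat (N0 ℓ Mh k P) μ)ᵀ) *ᵥ lam) x| ≤ E := by
    intro cq hc
    obtain ⟨-, hij, hji, -, -⟩ := fin_data hc
    have hjk := hc.hj.2
    -- `v_□(x) = 0` kills the term; otherwise `x` lies in the cube image
    by_cases hvx : uX (ℓ := ℓ) (Mh := Mh) (k := k) (P := P) cq x = 0
    · have hv0 : vX D cq x = 0 := by
        have : uFun ℓ Mh cq.1 cq.2 x.1 = 0 := hvx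
        show vFun D cq.1 cq.2 x.1 = 0
        unfold vFun; rw [this, zero_mul]
      have hrow : ∀ x', ((aX D a c hP cq hc)ᵀ * (dMat (N0 ℓ Mh k P) μ)ᵀ) x x' = 0 := by
        intro x'
        by_cases hxe : x'.1 + Pi.single μ 1 ∈ boxDom (N0 ℓ Mh k P)
        · rw [aXt_dMatt_apply hP cq hc μ x x' hxe, hv0, zero_mul]
        · exact aXt_dMatt_apply_off hP cq hc μ x x' hxe
      simp only [Matrix.mulVec, dotProduct, hrow, zero_mul, Finset.sum_const_zero, abs_zero]
      exact hE0
    obtain ⟨y, hy⟩ := img_of_uX_ne_zero hℓ hP hMh2 cq hc hvx (Or.inr rfl)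
    have hzval : ∀ w : ↥(boxDom (N0 ℓ Mh k P)), ((castP (ℓ := ℓ) (Mh := Mh) (P := P) hij hjk).symm w).1 = w.1 :=
      fun w => by unfold castP; exact boxCast_symm_apply_val _ _
    have hyx : (embC D hP cq hc y).1 = x.1 := by rw [hy, hzval]
    have hxin : InCube ℓ Mh k P cq.1 cq.2 x.1 := by
      rw [← hzval x]; exact (inCube_iff_exists_emb (Mh := Mh) hP hij hc.hq _).2 ⟨y, hy⟩
    have hlevwin := lev_window_of_inCube hℓ hR hP hMh2 hc x.2 hxin
    have hMh' : 1 ≤ MhP ℓ Mh cq.1 (fin D cq.1 cq.2) := one_le_MhP hMh1 _ _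
    have hcM' : ∀ ν, 1 ≤ cubeM' (MhP ℓ Mh cq.1 (fin D cq.1 cq.2)) (Pj ℓ k P cq.1) cq.2 ν := fun ν =>
      Nat.one_le_iff_ne_zero.2 (Nat.mul_ne_zero_iff.2
        ⟨by omega, by have := (one_le_cubeW (one_le_Pj hP cq.1) hc.hq ν).1; omega⟩)
    have hn1 : 1 ≤ (ℓ + 1) ^ fin D cq.1 cq.2 := Nat.one_le_pow _ _ (by omega)
    have hn : (0 : ℝ) < (((ℓ + 1) ^ fin D cq.1 cq.2 : ℕ) : ℝ) := by positivity
    have hncast : (((ℓ + 1) ^ fin D cq.1 cq.2 : ℕ) : ℝ) = ((ℓ : ℝ) + 1) ^ fin D cq.1 cq.2 := by push_cast; ring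
    obtain ⟨nn, hnn⟩ : ∃ t : ℝ, t = (((ℓ + 1) ^ fin D cq.1 cq.2 : ℕ) : ℝ) := ⟨_, rfl⟩
    have hnn0 : 0 < nn := by rw [hnn]; exact hn
    have hnnle : nn ≤ ((ℓ : ℝ) + 1) ^ D.lev x.1 := by rw [hnn, hncast]; exact pow_le_pow_right₀ hL1 hlevwin.1
    have hNj1 : 1 ≤ (ℓ + 1) ^ cq.1 := Nat.one_le_pow _ _ (by omega)
    have hM1 : 1 ≤ (ℓ + 1) * Mh := by nlinarith
    set Dd : ℝ := nn * (dist0 / (d + 1) - 1) with hDd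
    -- the row data of the cube: rows of `G′(□)` and the bond sums of `G′(□)∂*`
    have hrow : roww δ ((ℓ + 1) ^ fin D cq.1 cq.2) (cG D a c cq.1 (fin D cq.1 cq.2) cq.2 hP hc.hq) y ≤ c' :=
      (roww_mono hδa' _ _ _).trans (h243 (fin D cq.1 cq.2) (a (fin D cq.1 cq.2)) 0 (c (fin D cq.1 cq.2))
        (haw _).1 (haw _).2 le_rfl le_rfl (hcw _).1 (hcw _).2 _ hcM' _ y)
    have hrowd : roww δ ((ℓ + 1) ^ fin D cq.1 cq.2)
        (dstar ((ℓ + 1) ^ fin D cq.1 cq.2) μ (cG D a c cq.1 (fin D cq.1 cq.2) cq.2 hP hc.hq)) y ≤ cs :=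
      (roww_mono hδb' _ _ _).trans (h243s (fin D cq.1 cq.2) (a (fin D cq.1 cq.2)) 0 (c (fin D cq.1 cq.2))
        (haw _).1 (haw _).2 le_rfl le_rfl (hcw _).1 (hcw _).2 _ hcM'
        (lamLoc ℓ (MhP ℓ Mh cq.1 (fin D cq.1 cq.2)) (Pj ℓ k P cq.1) cq.2 (one_le_Pj hP cq.1) hc.hq
          (LamG D cq.1 (fin D cq.1 cq.2))) μ y)
    -- the entry bound, read on the cube: `|entry(x, x′_b)| ≤ r(b)` with
    -- `r(b) = (d+1)D₁·n·|G′(□)(y,b)| + n·|dstar G′(□)(y,b)|`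
    set r : ↥(Box d ℓ (fin D cq.1 cq.2)
        (fun μ => (ℓ + 1) * cubeM' (MhP ℓ Mh cq.1 (fin D cq.1 cq.2)) (Pj ℓ k P cq.1) cq.2 μ)) → ℝ :=
      fun b => (d + 1) * D1 hprof * nn * |cG D a c cq.1 (fin D cq.1 cq.2) cq.2 hP hc.hq y b|
        + nn * |dstar ((ℓ + 1) ^ fin D cq.1 cq.2) μ (cG D a c cq.1 (fin D cq.1 cq.2) cq.2 hP hc.hq) y b| with hr
    have hr0 : ∀ b, 0 ≤ r b := fun b => by positivity
    have hwrow : ∑ b, |r b| * Real.exp (δ * supNorm (y.1 - b.1) / nn)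
        ≤ nn * ((d + 1) * D1 hprof * c' + cs) := by
      have hsplit : ∀ b, |r b| * Real.exp (δ * supNorm (y.1 - b.1) / nn)
          = (d + 1) * D1 hprof * nn * (|cG D a c cq.1 (fin D cq.1 cq.2) cq.2 hP hc.hq y b|
              * Real.exp (δ * supNorm (y.1 - b.1) / nn))
            + nn * (|dstar ((ℓ + 1) ^ fin D cq.1 cq.2) μ (cG D a c cq.1 (fin D cq.1 cq.2) cq.2 hP hc.hq) y b|
              * Real.exp (δ * supNorm (y.1 - b.1) / nn)) := by
        intro b
        rw [abs_of_nonneg (hr0 b), hr]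
        ring
      simp_rw [hsplit]
      rw [Finset.sum_add_distrib, ← Finset.mul_sum, ← Finset.mul_sum]
      have h1 : ∑ b, |cG D a c cq.1 (fin D cq.1 cq.2) cq.2 hP hc.hq y b| * Real.exp (δ * supNorm (y.1 - b.1) / nn)
          ≤ c' := by rw [hnn]; exact hrow
      have h2 : ∑ b, |dstar ((ℓ + 1) ^ fin D cq.1 cq.2) μ (cG D a c cq.1 (fin D cq.1 cq.2) cq.2 hP hc.hq) y b|
          * Real.exp (δ * supNorm (y.1 - b.1) / nn) ≤ cs := by rw [hnn]; exact hrowd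
      calc (d + 1) * D1 hprof * nn * ∑ b, |cG D a c cq.1 (fin D cq.1 cq.2) cq.2 hP hc.hq y b|
              * Real.exp (δ * supNorm (y.1 - b.1) / nn)
            + nn * ∑ b, |dstar ((ℓ + 1) ^ fin D cq.1 cq.2) μ (cG D a c cq.1 (fin D cq.1 cq.2) cq.2 hP hc.hq) y b|
              * Real.exp (δ * supNorm (y.1 - b.1) / nn)
          ≤ (d + 1) * D1 hprof * nn * c' + nn * cs :=
            add_le_add (mul_le_mul_of_nonneg_left h1 (by positivity)) (mul_le_mul_of_nonneg_left h2 hnn0.le)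
        _ = nn * ((d + 1) * D1 hprof * c' + cs) := by ring
    -- the entries off the image vanish, on the image they are bounded by `|v(x)|·r(b)`
    have hent_off : ∀ x', (∀ b, castP (fin_data hc).2.1 hc.hj.2 (embC D hP cq hc b) ≠ x') →
        ((aX D a c hP cq hc)ᵀ * (dMat (N0 ℓ Mh k P) μ)ᵀ) x x' = 0 := by
      intro x' hx'
      have hx'' : ∀ b, embC D hP cq hc b ≠ (castP (ℓ := ℓ) (Mh := Mh) (P := P) hij hjk).symm x' := by
        intro b hb; exact hx' b (by rw [hb, Equiv.apply_symm_apply])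
      by_cases hxe : x'.1 + Pi.single μ 1 ∈ boxDom (N0 ℓ Mh k P)
      · rw [aXt_dMatt_apply hP cq hc μ x x' hxe, gX_apply_off hP cq hc hx'']
        -- `h_□(x′+e) ≠ 0` would force `x′` into the image
        have hu0 : uX (ℓ := ℓ) (Mh := Mh) (k := k) (P := P) cq ⟨x'.1 + Pi.single μ 1, hxe⟩ = 0 := by
          by_contra hu
          obtain ⟨b, hb⟩ := img_of_uX_ne_zero hℓ hP hMh2 cq hc hu (w := x')
            (Or.inl (mem_nbrs.2 ⟨μ, Or.inr (by simp)⟩))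
          exact hx'' b hb
        rw [hu0]; ring
      · exact aXt_dMatt_apply_off hP cq hc μ x x' hxe
    have hent_img : ∀ b, |((aX D a c hP cq hc)ᵀ * (dMat (N0 ℓ Mh k P) μ)ᵀ) x
        (castP (fin_data hc).2.1 hc.hj.2 (embC D hP cq hc b))| ≤ |vX D cq x| * r b := by
      intro b
      set x' : ↥(boxDom (N0 ℓ Mh k P)) := castP (fin_data hc).2.1 hc.hj.2 (embC D hP cq hc b) with hx'
      have hb : embC D hP cq hc b = (castP (ℓ := ℓ) (Mh := Mh) (P := P) hij hjk).symm x' := by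
        rw [hx', Equiv.symm_apply_apply]
      have hx'val : x'.1 = (embC D hP cq hc b).1 := by rw [hx']; unfold castP; exact boxCast_apply_val _ _
      by_cases hxe : x'.1 + Pi.single μ 1 ∈ boxDom (N0 ℓ Mh k P)
      swap
      · rw [aXt_dMatt_apply_off hP cq hc μ x x' hxe, abs_zero]; exact mul_nonneg (abs_nonneg _) (hr0 b)
      rw [aXt_dMatt_apply hP cq hc μ x x' hxe, gX_apply_img hP cq hc hy hb, abs_mul]
      refine mul_le_mul_of_nonneg_left ?_ (abs_nonneg _)
      -- first part: `|∂h|·n²|G| ≤ (d+1)D₁·n·|G|` (`n/L^{j_□} ≤ 1`)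
      have hdu : |uX (ℓ := ℓ) (Mh := Mh) (k := k) (P := P) cq ⟨x'.1 + Pi.single μ 1, hxe⟩
          - uX (ℓ := ℓ) (Mh := Mh) (k := k) (P := P) cq x'| ≤ (d + 1) * D1 hprof / (((ℓ + 1) ^ cq.1 : ℕ) : ℝ) := by
        have h := abs_hq_sub_le (d := d) hNj1 hM1 cq.2 x'.1 (x'.1 + Pi.single μ 1)
        have hs : supNorm (x'.1 + Pi.single μ 1 - x'.1) ≤ 1 := by
          rw [add_sub_cancel_left]; exact supNorm_single_le μ
        have hMr : (1 : ℝ) ≤ (((ℓ + 1) * Mh : ℕ) : ℝ) := by exact_mod_cast hM1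
        have hnj : (0 : ℝ) < (((ℓ + 1) ^ cq.1 : ℕ) : ℝ) := by positivity
        have hA0 : 0 ≤ (d + 1) * D1 hprof / (((ℓ + 1) * Mh : ℕ) : ℝ) := by positivity
        have h5 : (d + 1) * D1 hprof / (((ℓ + 1) * Mh : ℕ) : ℝ) * supNorm (x'.1 + Pi.single μ 1 - x'.1)
            ≤ (d + 1) * D1 hprof :=
          calc (d + 1) * D1 hprof / (((ℓ + 1) * Mh : ℕ) : ℝ) * supNorm (x'.1 + Pi.single μ 1 - x'.1)
              ≤ (d + 1) * D1 hprof / (((ℓ + 1) * Mh : ℕ) : ℝ) * 1 := mul_le_mul_of_nonneg_left hs hA0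
            _ = (d + 1) * D1 hprof / (((ℓ + 1) * Mh : ℕ) : ℝ) := mul_one _
            _ ≤ (d + 1) * D1 hprof := div_le_self (by positivity) hMr
        exact h.trans (div_le_div_of_nonneg_right h5 hnj.le)
      have hsq : nn * nn / (((ℓ + 1) ^ cq.1 : ℕ) : ℝ) ≤ nn := by
        have hnj : (0 : ℝ) < (((ℓ + 1) ^ cq.1 : ℕ) : ℝ) := by positivity
        rw [div_le_iff₀ hnj]
        refine mul_le_mul_of_nonneg_left ?_ hnn0.le
        rw [hnn]; exact_mod_cast Nat.pow_le_pow_right (by omega) hij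
      have hn2eq : ((((ℓ : ℝ) + 1)) ^ fin D cq.1 cq.2) ^ 2 = nn * nn := by rw [hnn, hncast]; ring
      have hp1 : |(uX (ℓ := ℓ) (Mh := Mh) (k := k) (P := P) cq ⟨x'.1 + Pi.single μ 1, hxe⟩
            - uX (ℓ := ℓ) (Mh := Mh) (k := k) (P := P) cq x')
          * (((((ℓ : ℝ) + 1)) ^ fin D cq.1 cq.2) ^ 2 * cG D a c cq.1 (fin D cq.1 cq.2) cq.2 hP hc.hq y b)|
          ≤ (d + 1) * D1 hprof * nn * |cG D a c cq.1 (fin D cq.1 cq.2) cq.2 hP hc.hq y b| := by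
        rw [abs_mul, abs_mul, hn2eq, abs_of_nonneg (mul_nonneg hnn0.le hnn0.le)]
        have hnj : (0 : ℝ) < (((ℓ + 1) ^ cq.1 : ℕ) : ℝ) := by positivity
        calc |uX cq ⟨x'.1 + Pi.single μ 1, hxe⟩ - uX cq x'| * (nn * nn * |cG D a c cq.1 (fin D cq.1 cq.2) cq.2 hP hc.hq y b|)
            ≤ (d + 1) * D1 hprof / (((ℓ + 1) ^ cq.1 : ℕ) : ℝ)
                * (nn * nn * |cG D a c cq.1 (fin D cq.1 cq.2) cq.2 hP hc.hq y b|) :=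
              mul_le_mul_of_nonneg_right hdu (by positivity)
          _ = (d + 1) * D1 hprof * (nn * nn / (((ℓ + 1) ^ cq.1 : ℕ) : ℝ))
                * |cG D a c cq.1 (fin D cq.1 cq.2) cq.2 hP hc.hq y b| := by
              field_simp
          _ ≤ (d + 1) * D1 hprof * nn * |cG D a c cq.1 (fin D cq.1 cq.2) cq.2 hP hc.hq y b| :=
              mul_le_mul_of_nonneg_right (mul_le_mul_of_nonneg_left hsq (by positivity)) (abs_nonneg _)
      -- second part: `|h(x′+e)|·|G(x,x′+e) − G(x,x′)| ≤ |dstar G(y,b)|` (zero unless `x′+e` is in the cube)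
      have hp2 : |uX (ℓ := ℓ) (Mh := Mh) (k := k) (P := P) cq ⟨x'.1 + Pi.single μ 1, hxe⟩
          * (gX D a c hP cq hc x ⟨x'.1 + Pi.single μ 1, hxe⟩
            - ((((ℓ : ℝ) + 1)) ^ fin D cq.1 cq.2) ^ 2 * cG D a c cq.1 (fin D cq.1 cq.2) cq.2 hP hc.hq y b)|
          ≤ nn * |dstar ((ℓ + 1) ^ fin D cq.1 cq.2) μ (cG D a c cq.1 (fin D cq.1 cq.2) cq.2 hP hc.hq) y b| := by
        by_cases hu : uX (ℓ := ℓ) (Mh := Mh) (k := k) (P := P) cq ⟨x'.1 + Pi.single μ 1, hxe⟩ = 0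
        · rw [hu, zero_mul, abs_zero]; exact mul_nonneg hnn0.le (abs_nonneg _)
        obtain ⟨be, hbe⟩ := img_of_uX_ne_zero hℓ hP hMh2 cq hc hu (Or.inr rfl)
        have hbeval : (embC D hP cq hc be).1 = x'.1 + Pi.single μ 1 := by rw [hbe, hzval]
        have hbe1 : be.1 = b.1 + Pi.single μ 1 := by
          have h1 : (embC D hP cq hc be).1 - (embC D hP cq hc b).1 = be.1 - b.1 := by
            unfold embC; exact emb_sub_emb _ hc.hq be b
          rw [hbeval, ← hx'val, add_sub_cancel_left, eq_comm, sub_eq_iff_eq_add'] at h1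
          exact h1
        have hfwd : fwd _ μ b = be := fwd_eq_of_nbr μ b be hbe1
        rw [gX_apply_img hP cq hc hy hbe, ← mul_sub, dstar_apply, hfwd, abs_mul, abs_mul, abs_mul, hn2eq,
          abs_of_nonneg (mul_nonneg hnn0.le hnn0.le), hnn, abs_of_nonneg hn.le]
        have huXe : |uX (ℓ := ℓ) (Mh := Mh) (k := k) (P := P) cq ⟨x'.1 + Pi.single μ 1, hxe⟩| ≤ 1 :=
          abs_hq_le_one _ _ _ _
        have hnn1 : (1 : ℝ) ≤ (((ℓ + 1) ^ fin D cq.1 cq.2 : ℕ) : ℝ) := by exact_mod_cast hn1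
        have habs0 : 0 ≤ |cG D a c cq.1 (fin D cq.1 cq.2) cq.2 hP hc.hq y be - cG D a c cq.1 (fin D cq.1 cq.2) cq.2 hP hc.hq y b| :=
          abs_nonneg _
        calc |uX cq ⟨x'.1 + Pi.single μ 1, hxe⟩|
              * ((((ℓ + 1) ^ fin D cq.1 cq.2 : ℕ) : ℝ) * (((ℓ + 1) ^ fin D cq.1 cq.2 : ℕ) : ℝ)
                * |cG D a c cq.1 (fin D cq.1 cq.2) cq.2 hP hc.hq y be - cG D a c cq.1 (fin D cq.1 cq.2) cq.2 hP hc.hq y b|)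
            ≤ 1 * ((((ℓ + 1) ^ fin D cq.1 cq.2 : ℕ) : ℝ) * (((ℓ + 1) ^ fin D cq.1 cq.2 : ℕ) : ℝ)
                * |cG D a c cq.1 (fin D cq.1 cq.2) cq.2 hP hc.hq y be - cG D a c cq.1 (fin D cq.1 cq.2) cq.2 hP hc.hq y b|) :=
              mul_le_mul_of_nonneg_right huXe (by positivity)
          _ = (((ℓ + 1) ^ fin D cq.1 cq.2 : ℕ) : ℝ) * ((((ℓ + 1) ^ fin D cq.1 cq.2 : ℕ) : ℝ)
                * |cG D a c cq.1 (fin D cq.1 cq.2) cq.2 hP hc.hq y be - cG D a c cq.1 (fin D cq.1 cq.2) cq.2 hP hc.hq y b|) := by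
              ring
      refine (abs_add_le _ _).trans ?_
      rw [hr]
      exact add_le_add hp1 hp2
    -- the row applied to `λ`: a sum over the cube, weighted decay against the block support
    have hsumx : (((aX D a c hP cq hc)ᵀ * (dMat (N0 ℓ Mh k P) μ)ᵀ) *ᵥ lam) x
        = ∑ b, ((aX D a c hP cq hc)ᵀ * (dMat (N0 ℓ Mh k P) μ)ᵀ) x (castP (fin_data hc).2.1 hc.hj.2 (embC D hP cq hc b))
            * lam (castP (fin_data hc).2.1 hc.hj.2 (embC D hP cq hc b)) := by
      simp only [Matrix.mulVec, dotProduct]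
      exact sum_eq_sum_cube hP cq hc _ fun x' hx' => by rw [hent_off x' hx', zero_mul]
    rw [hsumx]
    have hF : ∀ b, |(fun b => |lam (castP (fin_data hc).2.1 hc.hj.2 (embC D hP cq hc b))|) b| ≤ B := fun b => by
      simp only [abs_abs]; exact hlamB _
    have hD : ∀ b, (fun b => |lam (castP (fin_data hc).2.1 hc.hj.2 (embC D hP cq hc b))|) b ≠ 0 →
        Dd ≤ supNorm (y.1 - b.1) := by
      intro b hb
      set x'' : ↥(boxDom (N0 ℓ Mh k P)) := castP (fin_data hc).2.1 hc.hj.2 (embC D hP cq hc b) with hx''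
      have hμx : lam x'' ≠ 0 := fun h0 => hb (by
        show |lam (castP (fin_data hc).2.1 hc.hj.2 (embC D hP cq hc b))| = 0
        rw [← hx'', h0, abs_zero])
      have hx''val : x''.1 = (embC D hP cq hc b).1 := by rw [hx'']; unfold castP; exact boxCast_apply_val _ _
      have hx''in : InCube ℓ Mh k P cq.1 cq.2 x''.1 := by
        rw [hx''val]; exact (inCube_iff_exists_emb (Mh := Mh) hP hij hc.hq _).2 ⟨b, rfl⟩
      have hblk : blkOf D x'' = y' := by
        by_contra hne; exact hμx (hlam.off x'' hne)
      have h := Dd_le_supNorm hℓ hR hP hMh2 hc x x'' hxin hx''in y' hblk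
      have hsub : x.1 - x''.1 = y.1 - b.1 := by
        rw [hx''val, ← hyx]; unfold embC; exact emb_sub_emb _ hc.hq y b
      rw [hsub] at h
      rw [hDd, hnn]
      exact h
    have hcol := sum_mul_le_of_wrow hnn0 hB0 r
      (fun b => |lam (castP (fin_data hc).2.1 hc.hj.2 (embC D hP cq hc b))|)
      (fun b => supNorm (y.1 - b.1)) hwrow hF hD hδ0.le
    have hexp : Real.exp (-(δ * Dd / nn)) = Real.exp δ * Real.exp (-(δ / (d + 1) * dist0)) := by
      rw [hDd]; exact exp_Dd_eq hnn0 d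
    rw [hexp] at hcol
    have hvX : |vX D cq x| ≤ 1 := abs_vFun_le_one _ _ _
    calc |∑ b, ((aX D a c hP cq hc)ᵀ * (dMat (N0 ℓ Mh k P) μ)ᵀ) x (castP (fin_data hc).2.1 hc.hj.2 (embC D hP cq hc b))
            * lam (castP (fin_data hc).2.1 hc.hj.2 (embC D hP cq hc b))|
        ≤ ∑ b, |((aX D a c hP cq hc)ᵀ * (dMat (N0 ℓ Mh k P) μ)ᵀ) x (castP (fin_data hc).2.1 hc.hj.2 (embC D hP cq hc b))|
            * |lam (castP (fin_data hc).2.1 hc.hj.2 (embC D hP cq hc b))| := by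
          refine (Finset.abs_sum_le_sum_abs _ _).trans (le_of_eq (Finset.sum_congr rfl fun b _ => abs_mul _ _))
      _ ≤ ∑ b, (|vX D cq x| * r b) * |lam (castP (fin_data hc).2.1 hc.hj.2 (embC D hP cq hc b))| :=
          Finset.sum_le_sum fun b _ => mul_le_mul_of_nonneg_right (hent_img b) (abs_nonneg _)
      _ = |vX D cq x| * ∑ b, r b * |lam (castP (fin_data hc).2.1 hc.hj.2 (embC D hP cq hc b))| := by
          rw [Finset.mul_sum]; exact Finset.sum_congr rfl fun b _ => by ring
      _ ≤ 1 * (nn * ((d + 1) * D1 hprof * c' + cs) * (Real.exp δ * Real.exp (-(δ / (d + 1) * dist0))) * B) := by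
          refine mul_le_mul hvX ((le_abs_self _).trans hcol) ?_ zero_le_one
          exact Finset.sum_nonneg fun b _ => mul_nonneg (hr0 b) (abs_nonneg _)
      _ ≤ E := by
          rw [one_mul, hE, hQ]
          have : nn * ((d + 1) * D1 hprof * c' + cs) * (Real.exp δ * Real.exp (-(δ / (d + 1) * dist0))) * B
              = nn * ((((d + 1) * D1 hprof * c' + cs) * Real.exp δ) * Real.exp (-(δ / (d + 1) * dist0)) * B) := by
            ring
          rw [this]
          exact mul_le_mul_of_nonneg_right hnnle (by positivity)
  -- the terms with `h_□(x) = 0` vanish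
  have hzero : ∀ (cq : ℕ × (Fin (d + 1) → ℤ)) (hc : CubeData D cq),
      uX (ℓ := ℓ) (Mh := Mh) (k := k) (P := P) cq x = 0 →
        (((aX D a c hP cq hc)ᵀ * (dMat (N0 ℓ Mh k P) μ)ᵀ) *ᵥ lam) x = 0 := by
    intro cq hc hux
    have hv0 : vX D cq x = 0 := by
      have : uFun ℓ Mh cq.1 cq.2 x.1 = 0 := hux
      show vFun D cq.1 cq.2 x.1 = 0
      unfold vFun; rw [this, zero_mul]
    have hrow : ∀ x', ((aX D a c hP cq hc)ᵀ * (dMat (N0 ℓ Mh k P) μ)ᵀ) x x' = 0 := by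
      intro x'
      by_cases hxe : x'.1 + Pi.single μ 1 ∈ boxDom (N0 ℓ Mh k P)
      · rw [aXt_dMatt_apply hP cq hc μ x x' hxe, hv0, zero_mul]
      · exact aXt_dMatt_apply_off hP cq hc μ x x' hxe
    simp only [Matrix.mulVec, dotProduct, hrow, zero_mul, Finset.sum_const_zero]
  -- summing over the cover
  unfold gZeroML
  rw [Matrix.transpose_sum, Finset.sum_mul, Matrix.sum_mulVec, Finset.sum_apply, Finset.attach_eq_univ]
  have key := sum_le_card_mul
    (fun cq : {cq // cq ∈ cubeSet D} =>
      |(((aX D a c hP cq.1 (cubeData_of_mem cq.2))ᵀ * (dMat (N0 ℓ Mh k P) μ)ᵀ) *ᵥ lam) x|)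
    (fun cq => cq.1) Subtype.val_injective (keySet ℓ Mh (D.lev x.1) x.1)
    (fun cq hq0 => by
      by_contra hmem
      apply hq0
      have hux : uX (ℓ := ℓ) (Mh := Mh) (k := k) (P := P) cq.1 x = 0 := by
        by_contra h
        exact hmem (mem_keySet_of_uX_ne_zero hℓ hR hP hMh2 cq.1 (cubeData_of_mem cq.2) h)
      rw [hzero cq.1 (cubeData_of_mem cq.2) hux, abs_zero])
    hE0 (fun cq => hterm cq.1 (cubeData_of_mem cq.2))
  refine (mul_le_mul_of_nonneg_left ((Finset.abs_sum_le_sum_abs _ _).trans key) (by positivity)).trans ?_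
  have hcard : ((keySet ℓ Mh (D.lev x.1) x.1).card : ℝ) ≤ 3 * 2 ^ (d + 1) := by
    exact_mod_cast card_keySet_le _ _ _ _
  dsimp only
  rw [hgeom]
  have hrest : 0 ≤ Real.exp (-(δ / (d + 1) * dist0)) * B := by positivity
  have hLpos : 0 < ((ℓ : ℝ) + 1) ^ D.lev x.1 := by positivity
  calc (((ℓ : ℝ) + 1) ^ D.lev x.1)⁻¹ * (((keySet ℓ Mh (D.lev x.1) x.1).card : ℝ) * E)
      ≤ (((ℓ : ℝ) + 1) ^ D.lev x.1)⁻¹ * (3 * 2 ^ (d + 1) * E) :=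
        mul_le_mul_of_nonneg_left (mul_le_mul_of_nonneg_right hcard hE0) (by positivity)
    _ = 3 * 2 ^ (d + 1) * Q * (Real.exp (-(δ / (d + 1) * dist0)) * B) := by
        rw [hE]; field_simp
    _ ≤ (3 * 2 ^ (d + 1) * Q + 1) * (Real.exp (-(δ / (d + 1) * dist0)) * B) :=
        mul_le_mul_of_nonneg_right (by linarith) hrest
    _ = (3 * 2 ^ (d + 1) * Q + 1) * Real.exp (-(δ / (d + 1) * dist0)) * B := by ring

end TZeroMajorant

/-! ## §5 Proposition 2.2, third entry, for the genuine `k`-level operator -/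

section Prop22

variable {ℓ Mh k R : ℕ} {P : Fin (d + 1) → ℕ}

/-- `Λ = diag(L^{j(y(x))})`. [folklore] -/
private theorem levW_one_eq (D : Domains d ℓ Mh k P R) :
    levW D 1 = Matrix.diagonal (fun x => ((ℓ : ℝ) + 1) ^ (blkOf D x).1.1) := by
  unfold levW
  refine congrArg Matrix.diagonal (funext fun x => ?_)
  rw [zpow_one]
  rfl

/-- **[B6] PROPOSITION 2.2, THIRD ENTRY OF (2.67) (`G′∇^{η*}λ`), FOR THE GENUINE `k`-LEVEL OPERATOR `G′ = Δ′_a^{−1}` ON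
A BOX**: there are `δ₀, C, M₀ > 0` and `N₀ ≥ 1` (functions of `d`, `ℓ` and the windows) such that for EVERY number of
levels `k`, `M_h ≥ 3` with `L·M_h ≥ M₀` («M is sufficiently large»), `R ≥ 2L` with `RM ≥ N₀ + 1` ((2.59)), volume
`P`, nested family `D` of domains (2.1)–(2.2), weights `a_i ∈ [a₋, a₊]`, `c_i ∈ [c₋, c₊]` with
`a_{i+1} = aNext ℓ a_i c_i`, and every axis `μ`:
`|(G′∂_μᵀλ)(x)| ≤ C·L^{j}·e^{−½δ₀d(y,y′)}·|λ|` for `x ∈ B^j(y)`, `y ∈ Λ_j`, `supp λ ⊂ B^{j′}(y′)`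
(`HasMajorant` of `G′∂_μᵀ`, `(G′∂ᵀλ)(x) = Σ_z[G′(x,z+e_μ) − G′(x,z)]λ(z)`; lattice units: `L^{j}` for «L^jη») — by the
transposed fixed point `G′∂ᵀ = G′₀ᵀ∂ᵀ + Rᵀ(G′∂ᵀ)` conjugated by `Λ = diag(L^{j(x)})`, the invertibility of `1 − S`
from its row sums (`B6Prop23Chain.isUnit_one_sub`), the chain `B6Prop23Chain.majorant_of_fixedPoint_266W` for
`(1 − S)^{−1} = 1 + (1 − S)^{−1}S`, the left convolution and Lemma 2.1 on the box (file 4).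
[cite: Balaban1984PropagatorsII, Proposition 2.2 (2.67) p.234 (third entry), (2.64)–(2.66) p.234] -/
theorem prop22_third_multiLevelBox (d ℓ : ℕ) (hℓ : 1 ≤ ℓ) (aminus aplus a2minus a2plus : ℝ) (ha : 0 < aminus)
    (ha2 : 0 < a2minus) :
    ∃ δ₀ C M₀ : ℝ, ∃ N₀ : ℕ, 0 < δ₀ ∧ 0 < C ∧ 0 < M₀ ∧ 0 < N₀ ∧
      ∀ (k Mh R : ℕ), 3 ≤ Mh → M₀ ≤ ((ℓ : ℝ) + 1) * Mh → 2 * (ℓ + 1) ≤ R → N₀ + 1 ≤ R * ((ℓ + 1) * Mh) →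
      ∀ (P : Fin (d + 1) → ℕ) (hP : ∀ μ, 1 ≤ P μ) (D : Domains d ℓ Mh k P R) (a c : ℕ → ℝ),
        (∀ i, aminus ≤ a i ∧ a i ≤ aplus) → (∀ i, a2minus ≤ c i ∧ c i ≤ a2plus) →
        (∀ i, a (i + 1) = aNext ℓ (a i) (c i)) → ∀ μ : Fin (d + 1),
        HasMajorant (g := geom D) (blkOf D)
          (Matrix.toLin' (gml (N0 ℓ Mh k P) ℓ k D.lev a * (dMat (N0 ℓ Mh k P) μ)ᵀ))
          (fun y y' => C * ((ℓ : ℝ) + 1) ^ y.1.1 * Real.exp (-(δ₀ / 2 * (geom D).dist y y'))) := by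
  obtain ⟨δ₄, K', hδ₄, hK', hSmaj⟩ := sOp_majorant d ℓ hℓ aminus aplus a2minus a2plus ha ha2
  obtain ⟨δ₅, A, hδ₅, hA, hTmaj⟩ := tZero_majorant d ℓ hℓ aminus aplus a2minus a2plus ha ha2
  have hL0 : (0 : ℝ) < (ℓ : ℝ) + 1 := by positivity
  have hL1 : (1 : ℝ) ≤ (ℓ : ℝ) + 1 := by linarith [(Nat.cast_nonneg ℓ : (0 : ℝ) ≤ ℓ)]
  -- the rate `δ₀ = min(δ₄, δ₅)/(d+1)` and the (2.59)-threshold `N₀`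
  set δ₀ : ℝ := min δ₄ δ₅ / (d + 1) with hδ₀
  have hδ₀pos : 0 < δ₀ := by rw [hδ₀]; exact div_pos (lt_min hδ₄ hδ₅) (by positivity)
  set N₀ : ℕ := ⌈4 * ((d : ℝ) + 1) * ((ℓ : ℝ) + 1) / (1 / 2 * δ₀)⌉₊ + 1 with hN₀
  have hN₀pos : 0 < N₀ := by rw [hN₀]; omega
  have hθlt : Real.exp (-(1 / 2 * δ₀)) * ((ℓ : ℝ) + 1) ^ ((2 * (d + 1 : ℕ) : ℝ) / N₀) < 1 := by
    refine theta_lt_one_of_log hL0 hN₀pos ?_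
    have hlog : Real.log ((ℓ : ℝ) + 1) ≤ (ℓ : ℝ) + 1 := (Real.log_le_sub_one_of_pos hL0).trans (by linarith)
    have hN₀ge : 4 * ((d : ℝ) + 1) * ((ℓ : ℝ) + 1) / (1 / 2 * δ₀) < (N₀ : ℝ) := by
      rw [hN₀]; push_cast
      exact lt_of_le_of_lt (Nat.le_ceil _) (by linarith)
    have hσ : (0 : ℝ) < 1 / 2 * δ₀ := by positivity
    rw [div_lt_iff₀ hσ] at hN₀ge
    push_cast
    nlinarith [mul_nonneg (by positivity : (0 : ℝ) ≤ 2 * ((d : ℝ) + 1)) (Real.log_nonneg hL1)]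
  -- the (2.61)-constant and «M sufficiently large» (`M_h ≥ 2K′c + 1`, stated through `L·M_h`)
  set cK : ℝ := K261 N₀ (d + 1) ((ℓ : ℝ) + 1) 1 (1 / 2 * δ₀) with hcK
  have hcK0 : 0 ≤ cK := K261_nonneg (by positivity) zero_le_one
  set M₀ : ℝ := ((ℓ : ℝ) + 1) * (2 * K' * cK + 1) with hM₀
  refine ⟨δ₀, 2 * A * cK * cK + 1, M₀, N₀, hδ₀pos, by positivity, by positivity, hN₀pos, ?_⟩
  intro k Mh R hMh hM hR hRM P hP D a c haw hcw hac μ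
  have hMh1 : 1 ≤ Mh := le_trans (by norm_num) hMh
  have hMh2 : 2 ≤ Mh := le_trans (by norm_num) hMh
  have hMhr : (1 : ℝ) ≤ Mh := by exact_mod_cast hMh1
  have hMh0 : (0 : ℝ) < Mh := by linarith
  have hMhge : 2 * K' * cK + 1 ≤ (Mh : ℝ) := le_of_mul_le_mul_left (by rw [hM₀] at hM; exact hM) hL0
  have hapos : ∀ j, 0 < a j := fun j => lt_of_lt_of_le ha (haw j).1
  have hcpos : ∀ j, 0 < c j := fun j => lt_of_lt_of_le ha2 (hcw j).1
  -- geometry of the box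
  obtain ⟨-, h261, -, h263⟩ := lemma21_box D hMh1 hP hN₀pos hRM hδ₀pos.le (α := 1 / 2) (by norm_num)
    (by norm_num) hθlt
  obtain ⟨htri, hrefl, hdnn⟩ := triangle_refl_nonneg D hMh1 hP
  have hsymm : ∀ a b : (geom D).Site, (geom D).dist a b = (geom D).dist b a := fun a b => by
    show (((bond D).dist a b : ℕ) : ℝ) = (((bond D).dist b a : ℕ) : ℝ)
    rw [SimpleGraph.dist_comm]
  have hαδ : (0 : ℝ) ≤ (1 - 1 / 2) * δ₀ := by nlinarith [hδ₀pos.le]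
  -- the majorants of `S` and `T̃₀` at the common rate `δ₀`
  set θ : ℝ := K' / Mh with hθ
  have hθ0 : 0 ≤ θ := by positivity
  have hrate : ∀ (δ : ℝ), min δ₄ δ₅ ≤ δ → ∀ y y' : (geom D).Site,
      Real.exp (-(δ / (d + 1) * (geom D).dist y y')) ≤ Real.exp (-(δ₀ * (geom D).dist y y')) := by
    intro δ hδ y y'
    rw [Real.exp_le_exp, hδ₀, neg_le_neg_iff]
    exact mul_le_mul_of_nonneg_right (div_le_div_of_nonneg_right hδ (by positivity)) (hdnn y y')
  have hSm : HasMajorant (g := geom D) (blkOf D)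
      (Matrix.toLin' (levW D (-1) * (rML D a c hP)ᵀ * levW D 1))
      (fun y y' => θ * Real.exp (-(δ₀ * (geom D).dist y y'))) :=
    hasMajorant_mono (blkOf D) (hSmaj k Mh R hMh hR P hP D a c haw hcw) fun y y' =>
      mul_le_mul_of_nonneg_left (hrate δ₄ (min_le_left _ _) y y') hθ0
  have hT0m : HasMajorant (g := geom D) (blkOf D)
      (Matrix.toLin' (levW D (-1) * (gZeroML D a c hP)ᵀ * (dMat (N0 ℓ Mh k P) μ)ᵀ))
      (fun y y' => A * Real.exp (-(δ₀ * (geom D).dist y y'))) :=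
    hasMajorant_mono (blkOf D) (hTmaj k Mh R hMh hR P hP D a c haw hcw μ) fun y y' =>
      mul_le_mul_of_nonneg_left (hrate δ₅ (min_le_right _ _) y y') hA.le
  -- the smallness `θ·c ≤ ½` and the row sums of `S`
  have hsmall : θ * cK ≤ 1 / 2 := by
    rw [hθ, div_mul_eq_mul_div, div_le_iff₀ hMh0]
    nlinarith
  have hsmall' : θ * cK < 1 := by linarith
  have hrow : ∀ x, ∑ z, |mat (Matrix.toLin' (levW D (-1) * (rML D a c hP)ᵀ * levW D 1)) x z| ≤ θ * cK := by
    intro x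
    simp_rw [mat_toLin']
    refine (rowSum_le_of_hasMajorant (g := geom D) (blkOf D) hSm x).trans ?_
    calc ∑ y' : (geom D).Site, θ * Real.exp (-(δ₀ * (geom D).dist (blkOf D x) y'))
        ≤ ∑ y' : (geom D).Site, θ * Real.exp (-(1 / 2 * δ₀ * (geom D).dist (blkOf D x) y')) :=
          Finset.sum_le_sum fun y' _ => mul_le_mul_of_nonneg_left
            (Real.exp_le_exp.2 (by nlinarith [hdnn (blkOf D x) y', hδ₀pos.le])) hθ0
      _ = θ * ∑ y' : (geom D).Site, Real.exp (-(1 / 2 * δ₀ * (geom D).dist (blkOf D x) y')) := by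
          rw [Finset.mul_sum]
      _ ≤ θ * cK := mul_le_mul_of_nonneg_left (h261 (blkOf D x)) hθ0
  -- `U = (1 − S)^{−1} = 1 + U·S` and its majorant from the chain
  obtain ⟨u, hu⟩ := isUnit_one_sub hsmall' hrow
  set U : Module.End ℝ (↥(boxDom (N0 ℓ Mh k P)) → ℝ) := ↑u⁻¹ with hUdef
  have hUinv : U * (1 - Matrix.toLin' (levW D (-1) * (rML D a c hP)ᵀ * levW D 1)) = 1 := by
    rw [hUdef, ← hu, Units.inv_mul]
  have hfixU : U = 1 + U * Matrix.toLin' (levW D (-1) * (rML D a c hP)ᵀ * levW D 1) := by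
    have h := hUinv
    rw [mul_sub, mul_one, sub_eq_iff_eq_add] at h
    exact h
  have hUmaj := majorant_of_fixedPoint_266W (g := geom D) (blkOf D) cK δ₀ (1 / 2) θ 1 (fun _ => (1 : ℝ))
    zero_le_one (fun _ => zero_le_one) hθ0 hcK0 hαδ htri hrefl hdnn h261 h263 hsmall'
    (hasMajorant_one (blkOf D) δ₀ hrefl) hSm hfixU
  have hUmaj' : HasMajorant (g := geom D) (blkOf D) U
      (fun y y' => cK * (1 - θ * cK)⁻¹ * Real.exp (-((1 - 1 / 2) * δ₀ * (geom D).dist y y'))) :=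
    hasMajorant_mono (g := geom D) (blkOf D) hUmaj fun y y' => le_of_eq (by ring)
  -- `T̃ = U·T̃₀`
  have hconj := fixedPoint_conj D (c := c) hℓ hR hP hMh2 hapos hcpos hac (dMat (N0 ℓ Mh k P) μ)ᵀ
  have hconjL : Matrix.toLin' (levW D (-1) * (gml (N0 ℓ Mh k P) ℓ k D.lev a * (dMat (N0 ℓ Mh k P) μ)ᵀ))
      = Matrix.toLin' (levW D (-1) * (gZeroML D a c hP)ᵀ * (dMat (N0 ℓ Mh k P) μ)ᵀ)
        + Matrix.toLin' (levW D (-1) * (rML D a c hP)ᵀ * levW D 1)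
          * Matrix.toLin' (levW D (-1) * (gml (N0 ℓ Mh k P) ℓ k D.lev a * (dMat (N0 ℓ Mh k P) μ)ᵀ)) := by
    conv_lhs => rw [hconj]
    rw [map_add, Module.End.mul_eq_comp, ← Matrix.toLin'_mul, Matrix.mul_assoc (levW D (-1)) ((gZeroML D a c hP)ᵀ)]
  have hTt : Matrix.toLin' (levW D (-1) * (gml (N0 ℓ Mh k P) ℓ k D.lev a * (dMat (N0 ℓ Mh k P) μ)ᵀ))
      = U * Matrix.toLin' (levW D (-1) * (gZeroML D a c hP)ᵀ * (dMat (N0 ℓ Mh k P) μ)ᵀ) := by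
    have h1 : (1 - Matrix.toLin' (levW D (-1) * (rML D a c hP)ᵀ * levW D 1))
        * Matrix.toLin' (levW D (-1) * (gml (N0 ℓ Mh k P) ℓ k D.lev a * (dMat (N0 ℓ Mh k P) μ)ᵀ))
        = Matrix.toLin' (levW D (-1) * (gZeroML D a c hP)ᵀ * (dMat (N0 ℓ Mh k P) μ)ᵀ) := by
      rw [sub_mul, one_mul, sub_eq_iff_eq_add]
      exact hconjL
    calc Matrix.toLin' (levW D (-1) * (gml (N0 ℓ Mh k P) ℓ k D.lev a * (dMat (N0 ℓ Mh k P) μ)ᵀ))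
        = (U * (1 - Matrix.toLin' (levW D (-1) * (rML D a c hP)ᵀ * levW D 1)))
            * Matrix.toLin' (levW D (-1) * (gml (N0 ℓ Mh k P) ℓ k D.lev a * (dMat (N0 ℓ Mh k P) μ)ᵀ)) := by
          rw [hUinv, one_mul]
      _ = U * Matrix.toLin' (levW D (-1) * (gZeroML D a c hP)ᵀ * (dMat (N0 ℓ Mh k P) μ)ᵀ) := by
          rw [mul_assoc, h1]
  have hTtmaj : HasMajorant (g := geom D) (blkOf D)
      (Matrix.toLin' (levW D (-1) * (gml (N0 ℓ Mh k P) ℓ k D.lev a * (dMat (N0 ℓ Mh k P) μ)ᵀ)))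
      (fun y y' => cK * (1 - θ * cK)⁻¹ * A * cK * Real.exp (-((1 - 1 / 2) * δ₀ * (geom D).dist y y'))) := by
    rw [hTt]
    exact majorant_mul_left (blkOf D) hαδ htri hsymm h261 (by positivity) hA.le hUmaj' hT0m
  -- `T = Λ·T̃`
  have hT : gml (N0 ℓ Mh k P) ℓ k D.lev a * (dMat (N0 ℓ Mh k P) μ)ᵀ
      = Matrix.diagonal (fun x => ((ℓ : ℝ) + 1) ^ (blkOf D x).1.1)
        * (levW D (-1) * (gml (N0 ℓ Mh k P) ℓ k D.lev a * (dMat (N0 ℓ Mh k P) μ)ᵀ)) := by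
    rw [← levW_one_eq, ← Matrix.mul_assoc, levW_mul]
    norm_num
    rw [levW_zero, Matrix.one_mul]
  rw [hT]
  refine hasMajorant_mono (g := geom D) (blkOf D)
    (hasMajorant_diagonal_mul (g := geom D) (blkOf D) (fun y : ↥(bset D) => ((ℓ : ℝ) + 1) ^ y.1.1)
      (fun y => by positivity) _ hTtmaj)
    fun y y' => ?_
  have hinv : (1 - θ * cK)⁻¹ ≤ 2 := by
    rw [inv_le_comm₀ (by linarith) (by norm_num)]; linarith
  have hrate2 : Real.exp (-((1 - 1 / 2) * δ₀ * (geom D).dist y y')) = Real.exp (-(δ₀ / 2 * (geom D).dist y y')) := by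
    congr 1; ring
  rw [hrate2]
  have hP0 : 0 ≤ ((ℓ : ℝ) + 1) ^ y.1.1 := by positivity
  have he0 : 0 ≤ Real.exp (-(δ₀ / 2 * (geom D).dist y y')) := (Real.exp_pos _).le
  have h1 : cK * (1 - θ * cK)⁻¹ * A * cK ≤ 2 * A * cK * cK + 1 := by
    have : cK * (1 - θ * cK)⁻¹ * A * cK ≤ cK * 2 * A * cK :=
      mul_le_mul_of_nonneg_right (mul_le_mul_of_nonneg_right
        (mul_le_mul_of_nonneg_left hinv hcK0) hA.le) hcK0
    linarith
  calc ((ℓ : ℝ) + 1) ^ y.1.1 * (cK * (1 - θ * cK)⁻¹ * A * cK * Real.exp (-(δ₀ / 2 * (geom D).dist y y')))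
      = cK * (1 - θ * cK)⁻¹ * A * cK * (((ℓ : ℝ) + 1) ^ y.1.1 * Real.exp (-(δ₀ / 2 * (geom D).dist y y'))) := by
        ring
    _ ≤ (2 * A * cK * cK + 1) * (((ℓ : ℝ) + 1) ^ y.1.1 * Real.exp (-(δ₀ / 2 * (geom D).dist y y'))) :=
        mul_le_mul_of_nonneg_right h1 (mul_nonneg hP0 he0)
    _ = (2 * A * cK * cK + 1) * ((ℓ : ℝ) + 1) ^ y.1.1 * Real.exp (-(δ₀ / 2 * (geom D).dist y y')) := by ring

end Prop22

end

end Literature.MathematicalPhysics.QuantumFieldTheory.Balaban1983to89.B6Prop22AdjMultiLevelBoxL0
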